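import Literature.Computability.Complexity.Sipser2012
import Mathlib.Tactic.DeriveFintype
import Mathlib.Data.Fintype.Sigma
import Mathlib.Data.Fintype.Prod
import Mathlib.Data.Fintype.Option
import Mathlib.Data.Fintype.Sum
import Mathlib.Logic.Equiv.Fin.Basic
import Mathlib.Analysis.Asymptotics.Defs
import Mathlib.Tactic.Ring
import Mathlib.Tactic.Linarith
import HarnessLib

/-!
# Sipser Thm. 7.11, proved: `NTIME(t) ⊆ ⋃_c TIME(2^{c·t})` on the single-tape machine

Second sibling proof file of `Sipser2012.lean` (the first, `Sipser2012Proofs.lean`, proves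
`P ⊆ NP`, Thm. 7.31 and Thm. 7.35): it discharges the named fact
`Literature.Computability.Complexity.Sipser.NTIME_subset_TIME_two_pow` (Sipser 2012, Thm. 7.11:
for `t(n) ≥ n`, every `t(n)` time nondeterministic single-tape Turing machine has an equivalent
`2^{O(t(n))}` time deterministic single-tape Turing machine) by

* `NTIME_subset_TIME_two_pow_holds : NTIME_subset_TIME_two_pow`,

in the machine model of that file (`Sipser.TM` / `Sipser.NTM` over Mathlib's Post–Turing
machines `Turing.TM0`, one step = write or move, two-way infinite tape).

## The simulator (`NTIMEProof.simTM N`)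

Sipser's proof runs the breadth-first search of the computation tree of `N` from the proof of
Thm. 3.16 on three tapes (input, simulation tape, address string over `Γ_b`) and then invokes
Thm. 7.8 (multitape to single tape, quadratic slowdown). Multitape machines are not modelled in
the tree, so we build the single-tape simulator directly; the bound `2^{O(t)}` absorbs every
polynomial factor, which leaves room for a very simple machine:

* tape alphabet `Cell N`: seven tracks per cell — the input letter (never changed), a digit of
  the *master* copy of the current address string, the origin marker, the simulated symbol of
  `N` (`none` = never written: read through to the input letter or the blank), a digit of the
  *working* copy of the address string, the simulated head marker, and a trail bit. A digit
  (`Ch N = N.Λ × TM0.Stmt N.Γ`) names the transition of `N` to take; a digit not offered by `δ`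
  kills the branch (Sipser: "not every string is a valid address").
* rounds `k = 0, 1, 2, …`; in round `k` the master string runs through all of `(Ch N)^k` as a
  little-endian counter (`incrList`, `enum`, `ChainTo`); for each string: copy it onto the
  working track (`copy_loop`), simulate `N` from its start configuration following the working
  string, which is *carried along with the simulated head* (it always starts under the head;
  consuming a digit shifts the rest one cell left: `pull_B`, `macro_write/right/left`), with
  outcome (`runB`) `accept` (the simulator accepts), `dead`, or `alive` (string exhausted while
  `N` could still move); then sweep the dirty interval clean (`reset`: left to the first blank
  cell, right cleaning up to the first blank cell, back to the origin — correct because the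
  dirty cells form one interval on which every cell has a non-blank track, `Inv`,
  `Inv.ne_default`), increment the counter (`incr_loop`; on overflow: reject if no branch of
  this round was alive, else length `k + 1`), and repeat.
* correctness (`sim_spec`): computation branches of `N` correspond to address strings
  (`NCfg`, `APath`, `nrepr_reachesIn`, `nrepr_apath`, `runB_accept_of_apath`, …); if some
  branch of depth `k` is alive there is a branch of length `k + 1`, so by `N.RunsInTime f` the
  search stops by round `f n`, and it accepts iff `N` accepts (prefixes of accepting strings are
  accepting or alive, `runB_take_of_accept`).
* time (`Titer`, `budget`, `gbound_le`): a string of length `k` costs `≤ 12k² + 13k + 4n + 15`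
  steps, round `k` has `|Ch N|^k` strings, there are `≤ f n + 1` rounds, whence the simulator
  runs in time `g n ≤ 45 · 2^{(3 + |Ch N|)(f n + n + 2)} = 2^{O(t n)}` as `f = O(t)` and
  `n ≤ t n`.
* transfer to `Turing.TM0` (`CRepr`, `step_repr`, `run_repr`): all of the above is proved on
  abstract configurations (state, absolute head position, tape `ℤ → Cell N`); `Tape.nth`
  (`Tape.move_left_nth`, `Tape.move_right_nth`, `Tape.write_nth`) carries it to Mathlib tapes.

Nothing here is specific to Sipser's left-bounded tape or write-and-move steps: constant factors
are invisible in `TIME`, see the design notes of `Sipser2012.lean`.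

## References

* M. Sipser, *Introduction to the Theory of Computation*, 3rd ed., Cengage 2012, Thm. 7.11
  (statement lit p. 249, proof lit p. 250), Thm. 3.16 with its proof (the address-string search,
  lit p. 161-162; deciders: p. 162), Thm. 7.8 (lit p. 248). [Sipser2012] Page numbers `lit p. N` are
  the PDF pages of the held copy `book:sipser2012-introduction-theory-computation-3rd-ed`.
-/

namespace Literature.Computability.Complexity.Sipser

open Turing

namespace NTIMEProof

variable {α : Type} (N : NTM α)

/-! ### Finite bookkeeping types -/

/-- `Turing.Dir` is finite (a `def`, used as a LOCAL instance only: we add no global instance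
on a Mathlib type). [folklore] -/
@[reducible] def dirFintype : Fintype Dir :=
  ⟨{Dir.left, Dir.right}, by intro x; cases x <;> simp⟩

attribute [local instance] dirFintype

/-- Post–Turing statements over a finite alphabet form a finite type (local instance only).
[folklore] -/
@[reducible] def stmtFintype (Γ : Type) [Fintype Γ] : Fintype (TM0.Stmt Γ) :=
  Fintype.ofEquiv (Dir ⊕ Γ)
    { toFun := fun x => match x with
        | Sum.inl d => TM0.Stmt.move d
        | Sum.inr a => TM0.Stmt.write a
      invFun := fun s => match s with
        | TM0.Stmt.move d => Sum.inl d
        | TM0.Stmt.write a => Sum.inr a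
      left_inv := fun x => by cases x <;> rfl
      right_inv := fun s => by cases s <;> rfl }

attribute [local instance] stmtFintype

/-- A *choice digit*: a (state, statement) pair of `N`; a word of choice digits addresses a
branch of the computation tree (Sipser's strings over `Γ_b`). [folklore] -/
abbrev Ch : Type := N.Λ × TM0.Stmt N.Γ

/-- The number of choice digits. [folklore] -/
noncomputable def cN : ℕ := Fintype.card (Ch N)

/-- There is at least one choice digit. [folklore] -/
theorem cN_pos : 0 < cN N :=
  Fintype.card_pos_iff.2 ⟨(default, TM0.Stmt.move Dir.left)⟩

/-- A fixed enumeration of the choice digits. [folklore] -/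
noncomputable def enc : Ch N ≃ Fin (cN N) := Fintype.equivFin (Ch N)

/-- The first digit of the counter. [folklore] -/
noncomputable def dzero : Ch N := (enc N).symm ⟨0, cN_pos N⟩

/-- `d` is the last digit. [folklore] -/
def IsMax (d : Ch N) : Prop := (enc N d).val + 1 = cN N

/-- Successor digit (junk value `d` itself on the last digit, never used). [folklore] -/
noncomputable def dsucc (d : Ch N) : Ch N :=
  if h : (enc N d).val + 1 < cN N then (enc N).symm ⟨(enc N d).val + 1, h⟩ else d

/-! ### Strings laid out on the integer line -/

/-- `strTrack l i` is the `i`-th letter of `l` for `0 ≤ i < |l|` and `none` elsewhere.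
[folklore] -/
def strTrack {β : Type} : List β → ℤ → Option β
  | [], _ => none
  | d :: l, i => if i = 0 then some d else if 0 < i then strTrack l (i - 1) else none

section strTrack
variable {β : Type}

/-- The empty string occupies no cell. [folklore] -/
@[simp] theorem strTrack_nil (i : ℤ) : strTrack ([] : List β) i = none := rfl

/-- Cell `0` holds the first letter. [folklore] -/
@[simp] theorem strTrack_cons_zero (d : β) (l : List β) : strTrack (d :: l) 0 = some d := by
  simp [strTrack]

/-- Positive cells of `d :: l` are the cells of `l`, shifted. [folklore] -/
theorem strTrack_cons_pos (d : β) (l : List β) {i : ℤ} (hi : 0 < i) :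
    strTrack (d :: l) i = strTrack l (i - 1) := by
  rw [strTrack, if_neg (by omega), if_pos hi]

/-- Negative cells are empty. [folklore] -/
theorem strTrack_neg (l : List β) {i : ℤ} (hi : i < 0) : strTrack l i = none := by
  cases l with
  | nil => rfl
  | cons d l => rw [strTrack, if_neg (by omega), if_neg (by omega)]

/-- Cell `i + 1` of `d :: l` is cell `i` of `l`. [folklore] -/
theorem strTrack_cons_succ (d : β) (l : List β) (i : ℤ) (hi : 0 ≤ i) :
    strTrack (d :: l) (i + 1) = strTrack l i := by
  rw [strTrack_cons_pos d l (by omega)]; simp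

/-- Cells at or beyond the length are empty. [folklore] -/
theorem strTrack_of_length_le (l : List β) {i : ℤ} (hi : (l.length : ℤ) ≤ i) :
    strTrack l i = none := by
  induction l generalizing i with
  | nil => rfl
  | cons d l ih =>
    simp only [List.length_cons, Nat.cast_add, Nat.cast_one] at hi
    rw [strTrack_cons_pos d l (by omega)]
    exact ih (by omega)

/-- Cells inside the string are occupied. [folklore] -/
theorem strTrack_ne_none (l : List β) {i : ℤ} (h0 : 0 ≤ i) (hi : i < (l.length : ℤ)) :
    strTrack l i ≠ none := by
  induction l generalizing i with
  | nil => simp at hi; omega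
  | cons d l ih =>
    by_cases hz : i = 0
    · subst hz; simp
    · rw [strTrack_cons_pos d l (by omega)]
      simp only [List.length_cons, Nat.cast_add, Nat.cast_one] at hi
      exact ih (by omega) (by omega)

/-- A cell is empty iff it lies outside `[0, |l|)`. [folklore] -/
theorem strTrack_eq_none_iff (l : List β) (i : ℤ) :
    strTrack l i = none ↔ i < 0 ∨ (l.length : ℤ) ≤ i := by
  constructor
  · intro h
    by_contra hc
    push Not at hc
    exact strTrack_ne_none l hc.1 hc.2 h
  · rintro (h | h)
    · exact strTrack_neg l h
    · exact strTrack_of_length_le l h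

end strTrack

/-! ### The tape alphabet of the simulator: seven tracks -/

/-- A tape symbol of the deterministic simulator: the input letter (never changed), a digit
of the *master* copy of the current address string, the origin marker, the simulated symbol of
`N` (`none` = never written, read through to the input letter / blank), a digit of the
*working* copy of the address string (carried along with the simulated head), the simulated
head marker, and the trail bit (set on every cell the simulated head has left). [folklore] -/
@[ext]
structure Cell where
  /-- input track -/
  input : Option α
  /-- master address string -/
  master : Option (Ch N)
  /-- origin marker -/
  org : Bool
  /-- simulated tape of `N` (`none` = pristine) -/
  sim : Option N.Γ
  /-- working address string -/
  choice : Option (Ch N)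
  /-- simulated head is here -/
  hd : Bool
  /-- simulated head was here -/
  trail : Bool

/-- The blank cell: all tracks empty. [folklore] -/
instance cellInhabited : Inhabited (Cell N) := ⟨⟨none, none, false, none, none, false, false⟩⟩

/-- The blank cell has no input letter. [folklore] -/
@[simp] theorem default_input : (default : Cell N).input = none := rfl
/-- The blank cell has no master digit. [folklore] -/
@[simp] theorem default_master : (default : Cell N).master = none := rfl
/-- The blank cell is not the origin. [folklore] -/
@[simp] theorem default_org : (default : Cell N).org = false := rfl
/-- The blank cell has no simulated symbol. [folklore] -/
@[simp] theorem default_sim : (default : Cell N).sim = none := rfl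
/-- The blank cell has no working digit. [folklore] -/
@[simp] theorem default_choice : (default : Cell N).choice = none := rfl
/-- The blank cell carries no head marker. [folklore] -/
@[simp] theorem default_hd : (default : Cell N).hd = false := rfl
/-- The blank cell carries no trail bit. [folklore] -/
@[simp] theorem default_trail : (default : Cell N).trail = false := rfl

/-- The tape alphabet of the simulator is finite. [folklore] -/
noncomputable instance cellFintype [Fintype α] : Fintype (Cell N) :=
  Fintype.ofEquiv
    (Option α × Option (Ch N) × Bool × Option N.Γ × Option (Ch N) × Bool × Bool)
    { toFun := fun x => ⟨x.1, x.2.1, x.2.2.1, x.2.2.2.1, x.2.2.2.2.1, x.2.2.2.2.2.1, x.2.2.2.2.2.2⟩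
      invFun := fun s => (s.input, s.master, s.org, s.sim, s.choice, s.hd, s.trail)
      left_inv := fun _ => rfl
      right_inv := fun _ => rfl }

/-- The symbol of `N` represented by a cell: the simulated symbol if written, else the input
letter, else blank. [folklore] -/
def cur (s : Cell N) : N.Γ :=
  match s.sim with
  | some x => x
  | none => match s.input with
    | some a => N.inp a
    | none => default

/-- Erase everything a branch simulation may have written on a cell. [folklore] -/
def clean (s : Cell N) : Cell N :=
  { s with sim := none, choice := none, hd := false, trail := false }

/-! ### Control states and the transition table -/

/-- Phases of the *pull* subroutine (shift the working string one cell to the left). [folklore] -/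
inductive PullPh (C : Type) where
  | A | B | C1 (d : C) | C2 (d : C) | D | E | E2 | F
  deriving Fintype

/-- Phases of a simulated left move. [folklore] -/
inductive MlPh where
  | A | B | C
  deriving Fintype, DecidableEq

/-- Phases of a simulated right move. [folklore] -/
inductive MrPh where
  | A | B
  deriving Fintype, DecidableEq

/-- The bookkeeping phases between two branches. [folklore] -/
inductive AuxPh where
  | resetL | resetR | resetR2 | home | incr | incr2 | homeI | copy | copy2 | homeC
  deriving Fintype, DecidableEq

/-- Control states of the simulator (`al` = "some branch of the current length was still
alive when its address string ran out", `q` = simulated state of `N`). [folklore] -/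
inductive Ctrl where
  | start : Ctrl
  | acc : Ctrl
  | rej : Ctrl
  | sim (al : Bool) (q : N.Λ) : Ctrl
  | pull (al : Bool) (q : N.Λ) (k : Bool) (ph : PullPh (Ch N)) : Ctrl
  | ml (al : Bool) (q : N.Λ) (ph : MlPh) : Ctrl
  | mr (al : Bool) (q : N.Λ) (ph : MrPh) : Ctrl
  | aux (ph : AuxPh) (al : Bool) : Ctrl

/-- The start state of the simulator. [folklore] -/
instance ctrlInhabited : Inhabited (Ctrl N) := ⟨Ctrl.start⟩

/-- The state set of the simulator is finite. [folklore] -/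
noncomputable instance ctrlFintype : Fintype (Ctrl N) := by
  classical
  exact derive_fintype% _

/-- Continuation of the pull subroutine: back to simulating (`k = false`) or on to the second
half of a simulated left move (`k = true`). [folklore] -/
def kont (al : Bool) (q : N.Λ) : Bool → Ctrl N
  | false => Ctrl.sim al q
  | true => Ctrl.ml al q MlPh.A

open TM0.Stmt in
open scoped Classical in
/-- The transition table of the deterministic simulator. [folklore] -/
noncomputable def tr : Ctrl N → Cell N → Option (Ctrl N × TM0.Stmt (Cell N))
  | Ctrl.start, s => some (Ctrl.sim false default, write { s with org := true, hd := true })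
  | Ctrl.acc, _ => none
  | Ctrl.rej, _ => none
  | Ctrl.sim al q, s =>
    if q = N.accept then some (Ctrl.acc, write s)
    else match s.choice with
      | none =>
        some (Ctrl.aux AuxPh.resetL (al || decide (N.δ q (cur N s)).Nonempty), move Dir.left)
      | some d =>
        if d ∈ N.δ q (cur N s) then
          match d with
          | (q', write b) => some (Ctrl.pull al q' false PullPh.A, write { s with sim := some b })
          | (q', move Dir.right) =>
              some (Ctrl.mr al q' MrPh.A,
                write { s with choice := none, hd := false, trail := true })
          | (q', move Dir.left) => some (Ctrl.pull al q' true PullPh.B, move Dir.right)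
        else some (Ctrl.aux AuxPh.resetL al, move Dir.left)
  | Ctrl.pull al q k PullPh.A, _ => some (Ctrl.pull al q k PullPh.B, move Dir.right)
  | Ctrl.pull al q k PullPh.B, s =>
    match s.choice with
    | none => some (Ctrl.pull al q k PullPh.D, move Dir.left)
    | some d => some (Ctrl.pull al q k (PullPh.C1 d), write { s with choice := none })
  | Ctrl.pull al q k (PullPh.C1 d), _ => some (Ctrl.pull al q k (PullPh.C2 d), move Dir.left)
  | Ctrl.pull al q k (PullPh.C2 d), s =>
    some (Ctrl.pull al q k PullPh.E, write { s with choice := some d })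
  | Ctrl.pull al q k PullPh.E, _ => some (Ctrl.pull al q k PullPh.E2, move Dir.right)
  | Ctrl.pull al q k PullPh.E2, _ => some (Ctrl.pull al q k PullPh.B, move Dir.right)
  | Ctrl.pull al q k PullPh.D, s =>
    some (Ctrl.pull al q k PullPh.F, write { s with choice := none })
  | Ctrl.pull al q k PullPh.F, s =>
    if s.hd then some (kont N al q k, write s) else some (Ctrl.pull al q k PullPh.F, move Dir.left)
  | Ctrl.ml al q MlPh.A, s =>
    some (Ctrl.ml al q MlPh.B, write { s with hd := false, trail := true })
  | Ctrl.ml al q MlPh.B, _ => some (Ctrl.ml al q MlPh.C, move Dir.left)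
  | Ctrl.ml al q MlPh.C, s => some (Ctrl.pull al q false PullPh.A, write { s with hd := true })
  | Ctrl.mr al q MrPh.A, _ => some (Ctrl.mr al q MrPh.B, move Dir.right)
  | Ctrl.mr al q MrPh.B, s => some (Ctrl.sim al q, write { s with hd := true })
  | Ctrl.aux AuxPh.resetL al, s =>
    if s = default then some (Ctrl.aux AuxPh.resetR al, move Dir.right)
    else some (Ctrl.aux AuxPh.resetL al, move Dir.left)
  | Ctrl.aux AuxPh.resetR al, s =>
    if s = default then some (Ctrl.aux AuxPh.home al, move Dir.left)
    else some (Ctrl.aux AuxPh.resetR2 al, write (clean N s))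
  | Ctrl.aux AuxPh.resetR2 al, _ => some (Ctrl.aux AuxPh.resetR al, move Dir.right)
  | Ctrl.aux AuxPh.home al, s =>
    if s.org then some (Ctrl.aux AuxPh.incr al, write s)
    else some (Ctrl.aux AuxPh.home al, move Dir.left)
  | Ctrl.aux AuxPh.incr al, s =>
    match s.master with
    | some d =>
      if IsMax N d then some (Ctrl.aux AuxPh.incr2 al, write { s with master := some (dzero N) })
      else some (Ctrl.aux AuxPh.homeI al, write { s with master := some (dsucc N d) })
    | none =>
      if al then some (Ctrl.aux AuxPh.homeI false, write { s with master := some (dzero N) })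
      else some (Ctrl.rej, write s)
  | Ctrl.aux AuxPh.incr2 al, _ => some (Ctrl.aux AuxPh.incr al, move Dir.right)
  | Ctrl.aux AuxPh.homeI al, s =>
    if s.org then some (Ctrl.aux AuxPh.copy al, write s)
    else some (Ctrl.aux AuxPh.homeI al, move Dir.left)
  | Ctrl.aux AuxPh.copy al, s =>
    match s.master with
    | some d => some (Ctrl.aux AuxPh.copy2 al, write { s with choice := some d })
    | none => some (Ctrl.aux AuxPh.homeC al, write s)
  | Ctrl.aux AuxPh.copy2 al, _ => some (Ctrl.aux AuxPh.copy al, move Dir.right)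
  | Ctrl.aux AuxPh.homeC al, s =>
    if s.org then some (Ctrl.sim al default, write { s with hd := true })
    else some (Ctrl.aux AuxPh.homeC al, move Dir.left)

/-! ### Abstract configurations: control state, head position, tape as a function on `ℤ` -/

/-- An abstract configuration of the simulator. [folklore] -/
structure ACfg where
  /-- control state -/
  q : Ctrl N
  /-- absolute head position -/
  p : ℤ
  /-- tape contents by absolute position -/
  A : ℤ → Cell N

/-- One step of the simulator on abstract configurations. [folklore] -/
noncomputable def astep (c : ACfg N) : Option (ACfg N) :=
  match tr N c.q (c.A c.p) with
  | none => none
  | some (q', TM0.Stmt.move Dir.left) => some ⟨q', c.p - 1, c.A⟩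
  | some (q', TM0.Stmt.move Dir.right) => some ⟨q', c.p + 1, c.A⟩
  | some (q', TM0.Stmt.write s) => some ⟨q', c.p, Function.update c.A c.p s⟩

/-- `n` steps of the simulator. [folklore] -/
noncomputable def run (n : ℕ) (c : ACfg N) : Option (ACfg N) :=
  (flip bind (astep N))^[n] (some c)

/-- `Rn c n c'`: `c` reaches `c'` in exactly `n` steps. [folklore] -/
def Rn (c : ACfg N) (n : ℕ) (c' : ACfg N) : Prop := run N n c = some c'

/-- `RW c B c'`: `c` reaches `c'` within `B` steps. [folklore] -/
def RW (c : ACfg N) (B : ℕ) (c' : ACfg N) : Prop := ∃ n ≤ B, Rn N c n c'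

/-- A halted run stays halted. [folklore] -/
theorem iterate_bind_none (n : ℕ) : (flip bind (astep N))^[n] none = none := by
  induction n with
  | zero => rfl
  | succ n ih => rw [Function.iterate_succ_apply]; exact ih

/-- Zero steps. [folklore] -/
theorem run_zero (c : ACfg N) : run N 0 c = some c := rfl

/-- One step, then `n` steps. [folklore] -/
theorem run_succ (n : ℕ) (c : ACfg N) :
    run N (n + 1) c = (astep N c).bind (fun c' => run N n c') := by
  unfold run
  rw [Function.iterate_succ_apply]
  cases h : astep N c with
  | none => simpa [flip, h] using iterate_bind_none N n
  | some c' => simp [flip, h]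

/-- `m + n` steps are `m` steps followed by `n` steps. [folklore] -/
theorem run_add (m n : ℕ) (c : ACfg N) :
    run N (m + n) c = (run N m c).bind (fun c' => run N n c') := by
  induction m generalizing c with
  | zero => simp [run_zero]
  | succ m ih =>
    rw [Nat.succ_add, run_succ, run_succ]
    cases h : astep N c with
    | none => rfl
    | some c' => simpa using ih c'

variable {N}

/-- Reaching in `0` steps. [folklore] -/
theorem Rn.refl (c : ACfg N) : Rn N c 0 c := run_zero N c

/-- Reaching in one step. [folklore] -/
theorem Rn.one {c c' : ACfg N} (h : astep N c = some c') : Rn N c 1 c' := by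
  unfold Rn; rw [run_succ, h]; rfl

/-- Composition of exact-step reachability. [folklore] -/
theorem Rn.trans {c c' c'' : ACfg N} {m n : ℕ} (h₁ : Rn N c m c') (h₂ : Rn N c' n c'') :
    Rn N c (m + n) c'' := by
  unfold Rn at *; rw [run_add, h₁]; simpa using h₂

/-- One step followed by `n` steps. [folklore] -/
theorem Rn.step_trans {c c' c'' : ACfg N} {n : ℕ} (h₁ : astep N c = some c') (h₂ : Rn N c' n c'') :
    Rn N c (n + 1) c'' := by
  rw [Nat.add_comm]; exact (Rn.one h₁).trans h₂

/-- Transport of `Rn` along equalities of the target and the step count. [folklore] -/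
theorem Rn.cast {c c' c'' : ACfg N} {m n : ℕ} (h : Rn N c m c') (hc : c' = c'') (hm : m = n) :
    Rn N c n c'' := by
  subst hc hm; exact h

/-- Exact steps bound the steps. [folklore] -/
theorem Rn.toRW {c c' : ACfg N} {n : ℕ} (h : Rn N c n c') : RW N c n c' := ⟨n, le_rfl, h⟩

/-- Weakening the step bound. [folklore] -/
theorem RW.mono {c c' : ACfg N} {B B' : ℕ} (h : RW N c B c') (hB : B ≤ B') : RW N c B' c' := by
  obtain ⟨n, hn, h⟩ := h; exact ⟨n, hn.trans hB, h⟩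

/-- Composition of bounded reachability (bounds add). [folklore] -/
theorem RW.trans {c c' c'' : ACfg N} {B B' : ℕ} (h₁ : RW N c B c') (h₂ : RW N c' B' c'') :
    RW N c (B + B') c'' := by
  obtain ⟨m, hm, h₁⟩ := h₁
  obtain ⟨n, hn, h₂⟩ := h₂
  exact ⟨m + n, add_le_add hm hn, h₁.trans h₂⟩

/-- Composition of bounded reachability with a weaker total bound. [folklore] -/
theorem RW.trans_le {c c' c'' : ACfg N} {B B' B'' : ℕ} (h₁ : RW N c B c') (h₂ : RW N c' B' c'')
    (hB : B + B' ≤ B'') : RW N c B'' c'' :=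
  (h₁.trans h₂).mono hB


/-- Two abstract configurations with the same state agree if head and tape agree. [folklore] -/
theorem ACfg.mk_eq {q : Ctrl N} {p p' : ℤ} {A A' : ℤ → Cell N} (hp : p = p') (hA : A = A') :
    (⟨q, p, A⟩ : ACfg N) = ⟨q, p', A'⟩ := by subst hp hA; rfl

/-! ### Tracks: the tape as seven functions on `ℤ` -/

/-- The seven tracks of the simulator's tape as functions on `ℤ`. [folklore] -/
@[ext]
structure Tracks (N : NTM α) where
  /-- input track -/
  input : ℤ → Option α
  /-- master address string -/
  master : ℤ → Option (Ch N)
  /-- origin marker -/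
  org : ℤ → Bool
  /-- simulated symbols -/
  sim : ℤ → Option N.Γ
  /-- working address string -/
  choice : ℤ → Option (Ch N)
  /-- simulated head marker -/
  hd : ℤ → Bool
  /-- trail bits -/
  trail : ℤ → Bool

/-- Assemble the tracks into a tape. [folklore] -/
def toA (t : Tracks N) (i : ℤ) : Cell N :=
  ⟨t.input i, t.master i, t.org i, t.sim i, t.choice i, t.hd i, t.trail i⟩

/-- Input track of the assembled tape. [folklore] -/
@[simp] theorem toA_input (t : Tracks N) (i : ℤ) : (toA t i).input = t.input i := rfl
/-- Master track of the assembled tape. [folklore] -/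
@[simp] theorem toA_master (t : Tracks N) (i : ℤ) : (toA t i).master = t.master i := rfl
/-- Origin track of the assembled tape. [folklore] -/
@[simp] theorem toA_org (t : Tracks N) (i : ℤ) : (toA t i).org = t.org i := rfl
/-- Simulated track of the assembled tape. [folklore] -/
@[simp] theorem toA_sim (t : Tracks N) (i : ℤ) : (toA t i).sim = t.sim i := rfl
/-- Working track of the assembled tape. [folklore] -/
@[simp] theorem toA_choice (t : Tracks N) (i : ℤ) : (toA t i).choice = t.choice i := rfl
/-- Head-marker track of the assembled tape. [folklore] -/
@[simp] theorem toA_hd (t : Tracks N) (i : ℤ) : (toA t i).hd = t.hd i := rfl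
/-- Trail track of the assembled tape. [folklore] -/
@[simp] theorem toA_trail (t : Tracks N) (i : ℤ) : (toA t i).trail = t.trail i := rfl

/-- Writing one cell of the assembled tape updates every track at that cell. [folklore] -/
theorem update_toA (t : Tracks N) (p : ℤ) (s : Cell N) :
    Function.update (toA t) p s =
      toA ⟨Function.update t.input p s.input, Function.update t.master p s.master,
        Function.update t.org p s.org, Function.update t.sim p s.sim,
        Function.update t.choice p s.choice, Function.update t.hd p s.hd,
        Function.update t.trail p s.trail⟩ := by
  funext i
  by_cases h : i = p
  · subst h; simp [toA]
  · simp [Function.update_of_ne h, toA]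

/-! ### The pull subroutine -/

section Pull

variable (al : Bool) (q : N.Λ) (k : Bool)

/-- The pull loop: shifts the string `ds` sitting at `[i+1, i+|ds|]` to `[i, i+|ds|-1]`.
[folklore] -/
theorem pull_loop (ds : List (Ch N)) (i : ℤ) (t : Tracks N)
    (h : ∀ j, i + 1 ≤ j → t.choice j = strTrack ds (j - (i + 1))) :
    Rn N ⟨Ctrl.pull al q k PullPh.B, i + 1, toA t⟩ (5 * ds.length + 2)
      ⟨Ctrl.pull al q k PullPh.F, i + ds.length,
        toA { t with choice := fun j => if i ≤ j then strTrack ds (j - i) else t.choice j }⟩ := by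
  induction ds generalizing i t with
  | nil =>
    have h1 : t.choice (i + 1) = none := by rw [h (i + 1) le_rfl]; simp
    have e1 : astep N ⟨Ctrl.pull al q k PullPh.B, i + 1, toA t⟩ =
        some ⟨Ctrl.pull al q k PullPh.D, i, toA t⟩ := by
      simp [astep, tr, h1]
    have e2 : astep N ⟨Ctrl.pull al q k PullPh.D, i, toA t⟩ =
        some ⟨Ctrl.pull al q k PullPh.F, i,
          toA { t with choice := Function.update t.choice i none }⟩ := by
      simp [astep, tr, update_toA]
    refine (Rn.step_trans e1 (Rn.one e2)).cast ?_ (by simp)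
    have hc : Function.update t.choice i none =
        fun j => if i ≤ j then strTrack ([] : List (Ch N)) (j - i) else t.choice j := by
      funext j
      by_cases hji : j = i
      · subst hji; simp
      · rw [Function.update_of_ne hji]
        by_cases hj : i ≤ j
        · rw [if_pos hj, h j (by omega)]; simp
        · rw [if_neg hj]
    simp [hc]
  | cons d ds ih =>
    have h1 : t.choice (i + 1) = some d := by rw [h (i + 1) le_rfl]; simp
    have e1 : astep N ⟨Ctrl.pull al q k PullPh.B, i + 1, toA t⟩ =
        some ⟨Ctrl.pull al q k (PullPh.C1 d), i + 1,
          toA { t with choice := Function.update t.choice (i + 1) none }⟩ := by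
      simp [astep, tr, h1, update_toA]
    have e2 : astep N ⟨Ctrl.pull al q k (PullPh.C1 d), i + 1,
          toA { t with choice := Function.update t.choice (i + 1) none }⟩ =
        some ⟨Ctrl.pull al q k (PullPh.C2 d), i,
          toA { t with choice := Function.update t.choice (i + 1) none }⟩ := by
      simp [astep, tr]
    have e3 : astep N ⟨Ctrl.pull al q k (PullPh.C2 d), i,
          toA { t with choice := Function.update t.choice (i + 1) none }⟩ =
        some ⟨Ctrl.pull al q k PullPh.E, i,
          toA { t with choice :=
            Function.update (Function.update t.choice (i + 1) none) i (some d) }⟩ := by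
      simp [astep, tr, update_toA]
    have e4 : astep N ⟨Ctrl.pull al q k PullPh.E, i,
          toA { t with choice :=
            Function.update (Function.update t.choice (i + 1) none) i (some d) }⟩ =
        some ⟨Ctrl.pull al q k PullPh.E2, i + 1,
          toA { t with choice :=
            Function.update (Function.update t.choice (i + 1) none) i (some d) }⟩ := by
      simp [astep, tr]
    have e5 : astep N ⟨Ctrl.pull al q k PullPh.E2, i + 1,
          toA { t with choice :=
            Function.update (Function.update t.choice (i + 1) none) i (some d) }⟩ =
        some ⟨Ctrl.pull al q k PullPh.B, i + 1 + 1,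
          toA { t with choice :=
            Function.update (Function.update t.choice (i + 1) none) i (some d) }⟩ := by
      simp [astep, tr]
    have ih' := ih (i + 1)
      { t with choice := Function.update (Function.update t.choice (i + 1) none) i (some d) }
      (by
      intro j hj
      simp only
      rw [Function.update_of_ne (by omega), Function.update_of_ne (by omega), h j (by omega),
        strTrack_cons_pos d ds (by omega)]
      congr 1; omega)
    refine (Rn.step_trans e1 (Rn.step_trans e2 (Rn.step_trans e3 (Rn.step_trans e4
      (Rn.step_trans e5 ih'))))).cast ?_ ?_
    · refine ACfg.mk_eq (by simp only [List.length_cons]; push_cast; ring) ?_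
      congr 1
      simp only [Tracks.mk.injEq, and_true, true_and]
      funext j
      by_cases hj : i + 1 ≤ j
      · rw [if_pos hj, if_pos (by omega), strTrack_cons_pos d ds (by omega)]
        congr 1; omega
      · rw [if_neg hj]
        by_cases hji : j = i
        · subst hji; simp
        · rw [Function.update_of_ne hji, Function.update_of_ne (by omega), if_neg (by omega)]
    · simp only [List.length_cons]; ring

/-- Walking back from the end of the pulled string to the simulated head. [folklore] -/
theorem pull_return (m : ℕ) (i : ℤ) (t : Tracks N)
    (h : ∀ j, i < j → j ≤ i + m → t.hd j = false) (hi : t.hd i = true) :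
    Rn N ⟨Ctrl.pull al q k PullPh.F, i + m, toA t⟩ (m + 1) ⟨kont N al q k, i, toA t⟩ := by
  induction m with
  | zero =>
    have e : astep N ⟨Ctrl.pull al q k PullPh.F, i, toA t⟩ = some ⟨kont N al q k, i, toA t⟩ := by
      simp [astep, tr, hi, Function.update_eq_self]
    simpa using Rn.one e
  | succ m ih =>
    have hpos : i + ((m + 1 : ℕ) : ℤ) = i + m + 1 := by push_cast; ring
    have hf : t.hd (i + m + 1) = false := h (i + m + 1) (by omega) (by push_cast; omega)
    have e1 : astep N ⟨Ctrl.pull al q k PullPh.F, i + m + 1, toA t⟩ =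
        some ⟨Ctrl.pull al q k PullPh.F, i + m, toA t⟩ := by
      simp [astep, tr, hf]
    rw [hpos]
    exact (Rn.step_trans e1 (ih (fun j hj hj' => h j hj (by push_cast; omega)))).cast rfl
      (by omega)

/-- The whole pull subroutine entered at phase `B` one cell right of the simulated head `i`:
the string `ds` at `[i+1, i+|ds|]` ends up at `[i, i+|ds|-1]` and the head returns to `i`.
[folklore] -/
theorem pull_B (ds : List (Ch N)) (i : ℤ) (t : Tracks N)
    (h : ∀ j, i + 1 ≤ j → t.choice j = strTrack ds (j - (i + 1)))
    (hhd : ∀ j, i < j → j ≤ i + ds.length → t.hd j = false) (hi : t.hd i = true) :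
    Rn N ⟨Ctrl.pull al q k PullPh.B, i + 1, toA t⟩ (6 * ds.length + 3)
      ⟨kont N al q k, i,
        toA { t with choice := fun j => if i ≤ j then strTrack ds (j - i) else t.choice j }⟩ := by
  refine ((pull_loop al q k ds i t h).trans (pull_return al q k ds.length i _ ?_ ?_)).cast rfl
    (by ring)
  · intro j hj hj'; exact hhd j hj hj'
  · exact hi

end Pull


/-! ### The tracks during the simulation of a branch -/

/-- Updating a function with the value it already has there does nothing. [folklore] -/
theorem update_eq_self_of_eq {ι β : Type} [DecidableEq ι] {f : ι → β} {a : ι} {b : β}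
    (h : f a = b) : Function.update f a b = f := by
  subst h; exact Function.update_eq_self a f

section SimPhase

variable (N) in
/-- The initial tape of `N` by absolute position, given the input track `ι`. [folklore] -/
def S₀ (ι : ℤ → Option α) (i : ℤ) : N.Γ :=
  match ι i with
  | some a => N.inp a
  | none => default

variable (N) in
/-- The tape of `N` represented by the `sim` track `σ` over the input track `ι`. [folklore] -/
def Sof (ι : ℤ → Option α) (σ : ℤ → Option N.Γ) (i : ℤ) : N.Γ :=
  match σ i with
  | some x => x
  | none => S₀ N ι i

/-- The symbol of `N` represented by a cell of the assembled tape. [folklore] -/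
@[simp] theorem cur_toA (t : Tracks N) (i : ℤ) : cur N (toA t i) = Sof N t.input t.sim i := by
  simp only [cur, toA, Sof, S₀]

/-- Writing a simulated symbol updates the represented tape of `N`. [folklore] -/
theorem Sof_update (ι : ℤ → Option α) (σ : ℤ → Option N.Γ) (p : ℤ) (b : N.Γ) :
    Sof N ι (Function.update σ p (some b)) = Function.update (Sof N ι σ) p b := by
  funext i
  by_cases h : i = p
  · subst h; simp [Sof]
  · simp [Sof, Function.update_of_ne h]

variable (w : List α) (ms : List (Ch N))

variable (N) in
/-- The tracks while a branch is being simulated: input `w`, master string `ms`, simulated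
symbols `σ`, simulated head at `p` with the working string `ws` starting under it, trail
bits `trl`. [folklore] -/
abbrev simTracks (σ : ℤ → Option N.Γ) (p : ℤ) (ws : List (Ch N)) (trl : ℤ → Bool) : Tracks N :=
  { input := strTrack w, master := strTrack ms, org := fun i => decide (i = 0), sim := σ,
    choice := fun i => strTrack ws (i - p), hd := fun i => decide (i = p), trail := trl }

/-! Track algebra: closed forms of the track functions produced by the micro steps. -/

/-- Closed form of the head-marker track after a simulated move. [folklore] -/
theorem hdTrack_move (p p' : ℤ) (h : p' ≠ p) :
    Function.update (Function.update (fun i : ℤ => decide (i = p)) p false) p' true =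
      fun i => decide (i = p') := by
  funext i
  by_cases hi : i = p'
  · subst hi; simp
  · rw [Function.update_of_ne hi]
    by_cases hi' : i = p
    · subst hi'; simp [Ne.symm h]
    · rw [Function.update_of_ne hi']; simp [hi, hi']

/-- Closed form of the working track after dropping its first digit (right move). [folklore] -/
theorem chTrack_drop (d : Ch N) (ws : List (Ch N)) (p : ℤ) :
    Function.update (fun i : ℤ => strTrack (d :: ws) (i - p)) p none =
      fun i => strTrack ws (i - (p + 1)) := by
  funext i
  by_cases hi : i = p
  · subst hi; simp [strTrack_neg]
  · rw [Function.update_of_ne hi]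
    by_cases hi' : p < i
    · rw [strTrack_cons_pos _ _ (by omega)]; congr 1; omega
    · rw [strTrack_neg _ (by omega), strTrack_neg _ (by omega)]

/-- Closed form of the working track after a pull. [folklore] -/
theorem chTrack_pulled (ws ws' : List (Ch N)) (p p' : ℤ) (h : p' ≤ p) :
    (fun j : ℤ => if p' ≤ j then strTrack ws (j - p') else strTrack ws' (j - p)) =
      fun j => strTrack ws (j - p') := by
  funext j
  by_cases hj : p' ≤ j
  · rw [if_pos hj]
  · rw [if_neg hj, strTrack_neg _ (by omega), strTrack_neg _ (by omega)]

variable (al : Bool) (q q' : N.Λ)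

/-- Macro step: a simulated `write`. [folklore] -/
theorem macro_write (b : N.Γ) (σ : ℤ → Option N.Γ) (p : ℤ) (ws : List (Ch N)) (trl : ℤ → Bool)
    (hq : q ≠ N.accept) (hmem : (q', TM0.Stmt.write b) ∈ N.δ q (Sof N (strTrack w) σ p)) :
    Rn N ⟨Ctrl.sim al q, p, toA (simTracks N w ms σ p ((q', TM0.Stmt.write b) :: ws) trl)⟩
      (6 * ws.length + 5)
      ⟨Ctrl.sim al q', p, toA (simTracks N w ms (Function.update σ p (some b)) p ws trl)⟩ := by
  have e1 : astep N
        ⟨Ctrl.sim al q, p, toA (simTracks N w ms σ p ((q', TM0.Stmt.write b) :: ws) trl)⟩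
      = some ⟨Ctrl.pull al q' false PullPh.A, p,
          toA (simTracks N w ms (Function.update σ p (some b)) p
            ((q', TM0.Stmt.write b) :: ws) trl)⟩ := by
    simp [astep, tr, hq, hmem, update_toA, update_eq_self_of_eq]
  have e2 : astep N ⟨Ctrl.pull al q' false PullPh.A, p,
          toA (simTracks N w ms (Function.update σ p (some b)) p
            ((q', TM0.Stmt.write b) :: ws) trl)⟩
      = some ⟨Ctrl.pull al q' false PullPh.B, p + 1,
          toA (simTracks N w ms (Function.update σ p (some b)) p
            ((q', TM0.Stmt.write b) :: ws) trl)⟩ := by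
    simp [astep, tr]
  have e3 := pull_B al q' false ws p
    (simTracks N w ms (Function.update σ p (some b)) p ((q', TM0.Stmt.write b) :: ws) trl)
    (by
      intro j hj
      simp only
      rw [strTrack_cons_pos _ _ (by omega)]
      congr 1; omega)
    (by intro j hj _; simp only [decide_eq_false_iff_not]; omega)
    (by simp)
  refine (Rn.step_trans e1 (Rn.step_trans e2 e3)).cast ?_ (by ring)
  simp only [kont, chTrack_pulled ws _ p p le_rfl]

/-- Macro step: a simulated right move. [folklore] -/
theorem macro_right (σ : ℤ → Option N.Γ) (p : ℤ) (ws : List (Ch N)) (trl : ℤ → Bool)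
    (hq : q ≠ N.accept) (hmem : (q', TM0.Stmt.move Dir.right) ∈ N.δ q (Sof N (strTrack w) σ p)) :
    Rn N ⟨Ctrl.sim al q, p, toA (simTracks N w ms σ p ((q', TM0.Stmt.move Dir.right) :: ws) trl)⟩
      3 ⟨Ctrl.sim al q', p + 1,
        toA (simTracks N w ms σ (p + 1) ws (Function.update trl p true))⟩ := by
  have e1 : astep N
        ⟨Ctrl.sim al q, p, toA (simTracks N w ms σ p ((q', TM0.Stmt.move Dir.right) :: ws) trl)⟩
      = some ⟨Ctrl.mr al q' MrPh.A, p,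
          toA { simTracks N w ms σ (p + 1) ws (Function.update trl p true) with
            hd := Function.update (fun i => decide (i = p)) p false }⟩ := by
    simp [astep, tr, hq, hmem, update_toA, chTrack_drop]
  have e2 : astep N ⟨Ctrl.mr al q' MrPh.A, p,
          toA { simTracks N w ms σ (p + 1) ws (Function.update trl p true) with
            hd := Function.update (fun i => decide (i = p)) p false }⟩
      = some ⟨Ctrl.mr al q' MrPh.B, p + 1,
          toA { simTracks N w ms σ (p + 1) ws (Function.update trl p true) with
            hd := Function.update (fun i => decide (i = p)) p false }⟩ := by
    simp [astep, tr]
  have e3 : astep N ⟨Ctrl.mr al q' MrPh.B, p + 1,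
          toA { simTracks N w ms σ (p + 1) ws (Function.update trl p true) with
            hd := Function.update (fun i => decide (i = p)) p false }⟩
      = some ⟨Ctrl.sim al q', p + 1,
          toA (simTracks N w ms σ (p + 1) ws (Function.update trl p true))⟩ := by
    simp [astep, tr, update_toA, update_eq_self_of_eq, hdTrack_move p (p + 1) (by omega)]
  exact Rn.step_trans e1 (Rn.step_trans e2 (Rn.one e3))

/-- Macro step: a simulated left move. [folklore] -/
theorem macro_left (σ : ℤ → Option N.Γ) (p : ℤ) (ws : List (Ch N)) (trl : ℤ → Bool)
    (hq : q ≠ N.accept) (hmem : (q', TM0.Stmt.move Dir.left) ∈ N.δ q (Sof N (strTrack w) σ p)) :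
    Rn N ⟨Ctrl.sim al q, p, toA (simTracks N w ms σ p ((q', TM0.Stmt.move Dir.left) :: ws) trl)⟩
      (12 * ws.length + 11)
      ⟨Ctrl.sim al q', p - 1,
        toA (simTracks N w ms σ (p - 1) ws (Function.update trl p true))⟩ := by
  -- step 1: move right into the pull loop
  have e1 : astep N
        ⟨Ctrl.sim al q, p, toA (simTracks N w ms σ p ((q', TM0.Stmt.move Dir.left) :: ws) trl)⟩
      = some ⟨Ctrl.pull al q' true PullPh.B, p + 1,
          toA (simTracks N w ms σ p ((q', TM0.Stmt.move Dir.left) :: ws) trl)⟩ := by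
    simp [astep, tr, hq, hmem]
  -- first pull
  have e2 := pull_B al q' true ws p (simTracks N w ms σ p ((q', TM0.Stmt.move Dir.left) :: ws) trl)
    (by
      intro j hj
      simp only
      rw [strTrack_cons_pos _ _ (by omega)]
      congr 1; omega)
    (by intro j hj _; simp only [decide_eq_false_iff_not]; omega)
    (by simp)
  simp only [kont, chTrack_pulled ws _ p p le_rfl] at e2
  -- move the head marker one cell to the left
  have e3 : astep N ⟨Ctrl.ml al q' MlPh.A, p, toA (simTracks N w ms σ p ws trl)⟩
      = some ⟨Ctrl.ml al q' MlPh.B, p,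
          toA { simTracks N w ms σ p ws (Function.update trl p true) with
            hd := Function.update (fun i => decide (i = p)) p false }⟩ := by
    simp [astep, tr, update_toA, update_eq_self_of_eq]
  have e4 : astep N ⟨Ctrl.ml al q' MlPh.B, p,
          toA { simTracks N w ms σ p ws (Function.update trl p true) with
            hd := Function.update (fun i => decide (i = p)) p false }⟩
      = some ⟨Ctrl.ml al q' MlPh.C, p - 1,
          toA { simTracks N w ms σ p ws (Function.update trl p true) with
            hd := Function.update (fun i => decide (i = p)) p false }⟩ := by
    simp [astep, tr]
  have e5 : astep N ⟨Ctrl.ml al q' MlPh.C, p - 1,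
          toA { simTracks N w ms σ p ws (Function.update trl p true) with
            hd := Function.update (fun i => decide (i = p)) p false }⟩
      = some ⟨Ctrl.pull al q' false PullPh.A, p - 1,
          toA { simTracks N w ms σ p ws (Function.update trl p true) with
            hd := fun i => decide (i = p - 1) }⟩ := by
    simp [astep, tr, update_toA, update_eq_self_of_eq, hdTrack_move p (p - 1) (by omega)]
  have e6 : astep N ⟨Ctrl.pull al q' false PullPh.A, p - 1,
          toA { simTracks N w ms σ p ws (Function.update trl p true) with
            hd := fun i => decide (i = p - 1) }⟩
      = some ⟨Ctrl.pull al q' false PullPh.B, p - 1 + 1,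
          toA { simTracks N w ms σ p ws (Function.update trl p true) with
            hd := fun i => decide (i = p - 1) }⟩ := by
    simp [astep, tr]
  -- second pull
  have e7 := pull_B al q' false ws (p - 1)
    { simTracks N w ms σ p ws (Function.update trl p true) with hd := fun i => decide (i = p - 1) }
    (by intro j hj; simp)
    (by intro j hj _; simp only [decide_eq_false_iff_not]; omega)
    (by simp)
  refine (Rn.step_trans e1 (e2.trans (Rn.step_trans e3 (Rn.step_trans e4 (Rn.step_trans e5
    (Rn.step_trans e6 e7)))))).cast ?_ (by ring)
  simp only [kont, chTrack_pulled ws ws p (p - 1) (sub_le_self p zero_le_one)]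

end SimPhase


/-! ### Branch semantics and the branch lemma -/

/-- Outcome of following one address string. [folklore] -/
inductive Outcome where
  | accept | dead | alive
  deriving DecidableEq

section Branch

open scoped Classical in
variable (N) in
/-- The mathematical semantics of following the address string `ds` from the configuration
`(q, p, S)` of `N`: `accept` if the accepting state is met, `alive` if the string runs out
while `N` still has a move, `dead` otherwise (halting reject, or an invalid digit). [folklore] -/
noncomputable def runB : N.Λ → ℤ → (ℤ → N.Γ) → List (Ch N) → Outcome
  | q, p, S, [] =>
    if q = N.accept then Outcome.accept
    else if (N.δ q (S p)).Nonempty then Outcome.alive else Outcome.dead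
  | q, p, S, (q', TM0.Stmt.write b) :: ds =>
    if q = N.accept then Outcome.accept
    else if (q', TM0.Stmt.write b) ∈ N.δ q (S p) then runB q' p (Function.update S p b) ds
    else Outcome.dead
  | q, p, S, (q', TM0.Stmt.move Dir.left) :: ds =>
    if q = N.accept then Outcome.accept
    else if (q', TM0.Stmt.move Dir.left) ∈ N.δ q (S p) then runB q' (p - 1) S ds
    else Outcome.dead
  | q, p, S, (q', TM0.Stmt.move Dir.right) :: ds =>
    if q = N.accept then Outcome.accept
    else if (q', TM0.Stmt.move Dir.right) ∈ N.δ q (S p) then runB q' (p + 1) S ds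
    else Outcome.dead

variable (w : List α) (ms : List (Ch N))

/-- The invariant of the branch simulation (besides the shape `simTracks`): everything the
simulation touched lies in the trail interval `[lo, hi] ∋ 0, p`, whose size is bounded by the
number of digits consumed so far. [folklore] -/
structure Inv (p : ℤ) (σ : ℤ → Option N.Γ) (ws : List (Ch N)) (trl : ℤ → Bool) (lo hi : ℤ) :
    Prop where
  sim_supp : ∀ i, σ i ≠ none → lo ≤ i ∧ i ≤ hi
  trl_supp : ∀ i, trl i = true → lo ≤ i ∧ i ≤ hi
  trl_of : ∀ i, lo ≤ i → i ≤ hi → i ≠ p → trl i = true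
  tl_le_p : lo ≤ p
  p_le_tr : p ≤ hi
  tl_le : lo ≤ 0
  le_tr : 0 ≤ hi
  le_tl : -(ms.length : ℤ) + ws.length ≤ lo
  tr_le : hi ≤ (ms.length : ℤ) - ws.length
  ws_le : ws.length ≤ ms.length

variable {w ms}

/-- The invariant holds at the start of a branch. [folklore] -/
theorem Inv.start : Inv ms 0 (fun _ => none) ms (fun _ => false) 0 0 where
  sim_supp := by simp
  trl_supp := by simp
  trl_of := by intro i h1 h2 h3; omega
  tl_le_p := le_rfl
  p_le_tr := le_rfl
  tl_le := le_rfl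
  le_tr := le_rfl
  le_tl := by simp
  tr_le := by simp
  ws_le := le_rfl

/-- The invariant is preserved by a simulated write. [folklore] -/
theorem Inv.write {p : ℤ} {σ : ℤ → Option N.Γ} {d : Ch N} {ws : List (Ch N)} {trl : ℤ → Bool}
    {lo hi : ℤ} (h : Inv ms p σ (d :: ws) trl lo hi) (b : N.Γ) :
    Inv ms p (Function.update σ p (some b)) ws trl lo hi where
  sim_supp := by
    intro i hi
    by_cases hip : i = p
    · subst hip; exact ⟨h.tl_le_p, h.p_le_tr⟩
    · rw [Function.update_of_ne hip] at hi; exact h.sim_supp i hi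
  trl_supp := h.trl_supp
  trl_of := h.trl_of
  tl_le_p := h.tl_le_p
  p_le_tr := h.p_le_tr
  tl_le := h.tl_le
  le_tr := h.le_tr
  le_tl := by have := h.le_tl; simp only [List.length_cons] at this; push_cast at this; omega
  tr_le := by have := h.tr_le; simp only [List.length_cons] at this; push_cast at this; omega
  ws_le := by have := h.ws_le; simp only [List.length_cons] at this; omega

/-- The invariant is preserved by a simulated move. [folklore] -/
theorem Inv.move {p : ℤ} {σ : ℤ → Option N.Γ} {d : Ch N} {ws : List (Ch N)} {trl : ℤ → Bool}
    {lo hi : ℤ} (h : Inv ms p σ (d :: ws) trl lo hi) (p' : ℤ) (hp' : p' = p + 1 ∨ p' = p - 1) :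
    Inv ms p' σ ws (Function.update trl p true) (min lo p') (max hi p') where
  sim_supp := by
    intro i hi
    have := h.sim_supp i hi
    exact ⟨(min_le_left _ _).trans this.1, this.2.trans (le_max_left _ _)⟩
  trl_supp := by
    intro i hi
    by_cases hip : i = p
    · subst hip
      exact ⟨(min_le_left _ _).trans h.tl_le_p, h.p_le_tr.trans (le_max_left _ _)⟩
    · rw [Function.update_of_ne hip] at hi
      have := h.trl_supp i hi
      exact ⟨(min_le_left _ _).trans this.1, this.2.trans (le_max_left _ _)⟩
  trl_of := by
    intro i h1 h2 h3
    by_cases hip : i = p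
    · subst hip; simp
    · rw [Function.update_of_ne hip]
      have := h.tl_le_p; have := h.p_le_tr
      refine h.trl_of i ?_ ?_ hip
      · rcases hp' with rfl | rfl <;> · rw [min_le_iff] at h1; omega
      · rcases hp' with rfl | rfl <;> · rw [le_max_iff] at h2; omega
  tl_le_p := min_le_right _ _
  p_le_tr := le_max_right _ _
  tl_le := (min_le_left _ _).trans h.tl_le
  le_tr := h.le_tr.trans (le_max_left _ _)
  le_tl := by
    have h1 := h.le_tl; have h2 := h.tl_le_p
    simp only [List.length_cons] at h1; push_cast at h1
    rcases hp' with rfl | rfl <;> simp only [le_min_iff] <;> constructor <;> omega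
  tr_le := by
    have h1 := h.tr_le; have h2 := h.p_le_tr
    simp only [List.length_cons] at h1; push_cast at h1
    rcases hp' with rfl | rfl <;> simp only [max_le_iff] <;> constructor <;> omega
  ws_le := by have := h.ws_le; simp only [List.length_cons] at this; omega

variable (w ms)

/-- What the branch simulation delivers, by outcome. [folklore] -/
def BranchPost (al : Bool) (x : ACfg N) (B : ℕ) (o : Outcome) : Prop :=
  (o = Outcome.accept → ∃ (p' : ℤ) (A' : ℤ → Cell N), RW N x B ⟨Ctrl.acc, p', A'⟩) ∧
  (o ≠ Outcome.accept → ∃ (p' : ℤ) (σ' : ℤ → Option N.Γ) (ws' : List (Ch N)) (trl' : ℤ → Bool)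
      (lo' hi' : ℤ), Inv ms p' σ' ws' trl' lo' hi' ∧
      RW N x B ⟨Ctrl.aux AuxPh.resetL (al || decide (o = Outcome.alive)), p' - 1,
        toA (simTracks N w ms σ' p' ws' trl')⟩)

variable {w ms}

/-- Prefixing a bounded run to a branch postcondition. [folklore] -/
theorem BranchPost.of_RW {al : Bool} {x y : ACfg N} {B B' : ℕ} {o : Outcome}
    (h : RW N x B y) (hy : BranchPost w ms al y B' o) : BranchPost w ms al x (B + B') o := by
  refine ⟨fun ho => ?_, fun ho => ?_⟩
  · obtain ⟨p', A', h'⟩ := hy.1 ho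
    exact ⟨p', A', h.trans h'⟩
  · obtain ⟨p', σ', ws', trl', lo', hi', hI, h'⟩ := hy.2 ho
    exact ⟨p', σ', ws', trl', lo', hi', hI, h.trans h'⟩

/-- Weakening the step bound of a branch postcondition. [folklore] -/
theorem BranchPost.mono {al : Bool} {x : ACfg N} {B B' : ℕ} {o : Outcome}
    (hy : BranchPost w ms al x B o) (hB : B ≤ B') : BranchPost w ms al x B' o := by
  refine ⟨fun ho => ?_, fun ho => ?_⟩
  · obtain ⟨p', A', h'⟩ := hy.1 ho
    exact ⟨p', A', h'.mono hB⟩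
  · obtain ⟨p', σ', ws', trl', lo', hi', hI, h'⟩ := hy.2 ho
    exact ⟨p', σ', ws', trl', lo', hi', hI, h'.mono hB⟩

variable (w ms) (al : Bool)

/-- **Branch lemma.** From the start of a branch phase (shape `simTracks`, invariant `Inv`),
the simulator follows `runB`: it accepts if the outcome is `accept`, and otherwise enters the
reset phase one cell left of the simulated head with the alive flag updated, within
`12·|ws|² + 1` steps. [folklore] -/
theorem branch (ws : List (Ch N)) :
    ∀ (q : N.Λ) (p : ℤ) (σ : ℤ → Option N.Γ) (trl : ℤ → Bool) (lo hi : ℤ),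
      Inv ms p σ ws trl lo hi →
      BranchPost w ms al ⟨Ctrl.sim al q, p, toA (simTracks N w ms σ p ws trl)⟩
        (12 * ws.length ^ 2 + 1) (runB N q p (Sof N (strTrack w) σ) ws) := by
  induction ws with
  | nil =>
    intro q p σ trl lo hi hI
    by_cases hq : q = N.accept
    · have e : astep N ⟨Ctrl.sim al q, p, toA (simTracks N w ms σ p [] trl)⟩ =
          some ⟨Ctrl.acc, p, toA (simTracks N w ms σ p [] trl)⟩ := by
        simp [astep, tr, hq]
      have ho : runB N q p (Sof N (strTrack w) σ) [] = Outcome.accept := by simp [runB, hq]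
      rw [ho]
      exact ⟨fun _ => ⟨p, _, (Rn.one e).toRW.mono (by simp)⟩, fun h => (h rfl).elim⟩
    · have e : astep N ⟨Ctrl.sim al q, p, toA (simTracks N w ms σ p [] trl)⟩ =
          some ⟨Ctrl.aux AuxPh.resetL (al || decide (N.δ q (Sof N (strTrack w) σ p)).Nonempty),
            p - 1, toA (simTracks N w ms σ p [] trl)⟩ := by
        simp [astep, tr, hq]
      refine ⟨fun ho => ?_, fun ho => ⟨p, σ, [], trl, lo, hi, hI, ?_⟩⟩
      · exfalso; revert ho
        unfold runB; rw [if_neg hq]; split_ifs <;> simp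
      · have h := (Rn.one e).toRW.mono (show 1 ≤ 12 * ([] : List (Ch N)).length ^ 2 + 1 by simp)
        convert h using 4
        by_cases hne : (N.δ q (Sof N (strTrack w) σ p)).Nonempty <;> simp [runB, hq, hne]
  | cons d ws ih =>
    intro q p σ trl lo hi hI
    by_cases hq : q = N.accept
    · have e : astep N ⟨Ctrl.sim al q, p, toA (simTracks N w ms σ p (d :: ws) trl)⟩ =
          some ⟨Ctrl.acc, p, toA (simTracks N w ms σ p (d :: ws) trl)⟩ := by
        simp [astep, tr, hq]
      have ho : runB N q p (Sof N (strTrack w) σ) (d :: ws) = Outcome.accept := by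
        obtain ⟨q', ⟨_ | _⟩ | b⟩ := d <;> simp [runB, hq]
      rw [ho]
      exact ⟨fun _ => ⟨p, _, (Rn.one e).toRW.mono (by simp)⟩, fun h => (h rfl).elim⟩
    · by_cases hmem : d ∈ N.δ q (Sof N (strTrack w) σ p)
      · -- a genuine step of `N`
        have hB : 12 * ws.length + 11 + (12 * ws.length ^ 2 + 1) ≤
            12 * (d :: ws).length ^ 2 + 1 := by
          simp only [List.length_cons]; nlinarith
        obtain ⟨q', ⟨_ | _⟩ | b⟩ := d
        · -- move left
          have hm := macro_left w ms al q q' σ p ws trl hq hmem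
          have ho : runB N q p (Sof N (strTrack w) σ) ((q', TM0.Stmt.move Dir.left) :: ws) =
              runB N q' (p - 1) (Sof N (strTrack w) σ) ws := by simp [runB, hq, hmem]
          rw [ho]
          exact (BranchPost.of_RW hm.toRW
            (ih q' (p - 1) σ _ _ _ (hI.move (p - 1) (Or.inr rfl)))).mono hB
        · -- move right
          have hm := macro_right w ms al q q' σ p ws trl hq hmem
          have ho : runB N q p (Sof N (strTrack w) σ) ((q', TM0.Stmt.move Dir.right) :: ws) =
              runB N q' (p + 1) (Sof N (strTrack w) σ) ws := by simp [runB, hq, hmem]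
          rw [ho]
          exact (BranchPost.of_RW (hm.toRW.mono (by omega))
            (ih q' (p + 1) σ _ _ _ (hI.move (p + 1) (Or.inl rfl)))).mono hB
        · -- write
          have hm := macro_write w ms al q q' b σ p ws trl hq hmem
          have ho : runB N q p (Sof N (strTrack w) σ) ((q', TM0.Stmt.write b) :: ws) =
              runB N q' p (Sof N (strTrack w) (Function.update σ p (some b))) ws := by
            simp [runB, hq, hmem, Sof_update]
          rw [ho]
          exact (BranchPost.of_RW (hm.toRW.mono (by omega))
            (ih q' p _ trl lo hi (hI.write b))).mono hB
      · -- invalid digit: dead branch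
        have e : astep N ⟨Ctrl.sim al q, p, toA (simTracks N w ms σ p (d :: ws) trl)⟩ =
            some ⟨Ctrl.aux AuxPh.resetL al, p - 1, toA (simTracks N w ms σ p (d :: ws) trl)⟩ := by
          obtain ⟨q', ⟨_ | _⟩ | b⟩ := d <;> simp [astep, tr, hq, hmem]
        have ho : runB N q p (Sof N (strTrack w) σ) (d :: ws) = Outcome.dead := by
          obtain ⟨q', ⟨_ | _⟩ | b⟩ := d <;> simp [runB, hq, hmem]
        rw [ho]
        refine ⟨fun h => (by cases h), fun _ => ⟨p, σ, d :: ws, trl, lo, hi, hI, ?_⟩⟩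
        simpa using (Rn.one e).toRW.mono (by simp)

end Branch


/-! ### The reset phase (on raw tapes) -/

section Reset

variable (al : Bool)

/-- Walking left over non-blank cells until the first blank one, then stepping right. [folklore] -/
theorem resetL_walk (m : ℕ) : ∀ (j : ℤ) (A : ℤ → Cell N),
    (∀ i, j - m < i → i ≤ j → A i ≠ default) → A (j - m) = default →
    Rn N ⟨Ctrl.aux AuxPh.resetL al, j, A⟩ (m + 1) ⟨Ctrl.aux AuxPh.resetR al, j - m + 1, A⟩ := by
  induction m with
  | zero =>
    intro j A _ h0
    simp only [Nat.cast_zero, sub_zero] at h0 ⊢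
    exact Rn.one (by simp [astep, tr, h0])
  | succ m ih =>
    intro j A h h0
    have hj : A j ≠ default := h j (by push_cast; omega) le_rfl
    have e1 : astep N ⟨Ctrl.aux AuxPh.resetL al, j, A⟩ =
        some ⟨Ctrl.aux AuxPh.resetL al, j - 1, A⟩ := by
      simp [astep, tr, hj]
    refine (Rn.step_trans e1 (ih (j - 1) A (fun i h1 h2 => h i (by push_cast at h1 ⊢; omega)
      (by omega)) (by rw [← h0]; congr 1; push_cast; ring))).cast ?_ rfl
    refine ACfg.mk_eq (by push_cast; ring) rfl

variable (N) in
/-- Clean the cells `[i, i+m)` of a raw tape. [folklore] -/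
def cleanA (A : ℤ → Cell N) (i : ℤ) (m : ℕ) : ℤ → Cell N :=
  fun i' => if i ≤ i' ∧ i' < i + m then clean N (A i') else A i'

/-- The cleaning sweep: right over non-blank cells, cleaning each, until the first blank.
[folklore] -/
theorem resetR_loop (m : ℕ) : ∀ (i : ℤ) (A : ℤ → Cell N),
    (∀ i', i ≤ i' → i' < i + m → A i' ≠ default) → A (i + m) = default →
    Rn N ⟨Ctrl.aux AuxPh.resetR al, i, A⟩ (2 * m + 1)
      ⟨Ctrl.aux AuxPh.home al, i + m - 1, cleanA N A i m⟩ := by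
  induction m with
  | zero =>
    intro i A _ h0
    simp only [Nat.cast_zero, add_zero] at h0 ⊢
    have hc : cleanA N A i 0 = A := by
      funext i'; simp only [cleanA, Nat.cast_zero, add_zero]; rw [if_neg (by omega)]
    rw [hc]
    exact Rn.one (by simp [astep, tr, h0])
  | succ m ih =>
    intro i A h h0
    have hi : A i ≠ default := h i le_rfl (by push_cast; omega)
    have e1 : astep N ⟨Ctrl.aux AuxPh.resetR al, i, A⟩ =
        some ⟨Ctrl.aux AuxPh.resetR2 al, i, Function.update A i (clean N (A i))⟩ := by
      simp [astep, tr, hi]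
    have e2 : astep N ⟨Ctrl.aux AuxPh.resetR2 al, i, Function.update A i (clean N (A i))⟩ =
        some ⟨Ctrl.aux AuxPh.resetR al, i + 1, Function.update A i (clean N (A i))⟩ := by
      simp [astep, tr]
    have ih' := ih (i + 1) (Function.update A i (clean N (A i)))
      (fun i' h1 h2 => by
        rw [Function.update_of_ne (by omega)]; exact h i' (by omega) (by push_cast at h2 ⊢; omega))
      (by rw [Function.update_of_ne (by omega), ← h0]; congr 1; push_cast; ring)
    refine (Rn.step_trans e1 (Rn.step_trans e2 ih')).cast ?_ (by ring)
    refine ACfg.mk_eq (by push_cast; ring) ?_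
    funext i'
    simp only [cleanA]
    by_cases h1 : i' = i
    · subst h1
      rw [if_neg (by omega), if_pos (by constructor <;> [rfl; (push_cast; omega)])]
      simp
    · rw [Function.update_of_ne h1]
      by_cases h2 : i + 1 ≤ i' ∧ i' < i + 1 + m
      · rw [if_pos h2, if_pos (by push_cast; omega)]
      · rw [if_neg h2, if_neg (by push_cast; omega)]

/-- Walking left to the origin marker. [folklore] -/
theorem home_walk (m : ℕ) (A : ℤ → Cell N) (h : ∀ i : ℤ, 0 < i → i ≤ m → (A i).org = false)
    (h0 : (A 0).org = true) :
    Rn N ⟨Ctrl.aux AuxPh.home al, m, A⟩ (m + 1) ⟨Ctrl.aux AuxPh.incr al, 0, A⟩ := by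
  induction m with
  | zero =>
    exact Rn.one (by simp [astep, tr, h0])
  | succ m ih =>
    have hm : (A (m + 1)).org = false := h (m + 1) (by omega) (by push_cast; omega)
    have e1 : astep N ⟨Ctrl.aux AuxPh.home al, m + 1, A⟩ =
        some ⟨Ctrl.aux AuxPh.home al, m, A⟩ := by
      simp [astep, tr, hm]
    push_cast
    exact Rn.step_trans e1 (ih fun i h1 h2 => h i h1 (by push_cast; omega))

/-- Cleaning does not touch the origin track. [folklore] -/
theorem cleanA_org (A : ℤ → Cell N) (i : ℤ) (m : ℕ) (j : ℤ) :
    (cleanA N A i m j).org = (A j).org := by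
  simp only [cleanA]; split_ifs <;> rfl

/-- **Reset lemma.** If the non-blank cells form exactly the interval `[L, R] ∋ 0` with the
origin marker only at `0`, then from `resetL` at `p - 1` (`L ≤ p ≤ R`) the simulator cleans
`[L, R]` and stops at the origin in phase `incr`. [folklore] -/
theorem reset (A : ℤ → Cell N) (L R p : ℤ)
    (h1 : ∀ i, L ≤ i → i ≤ R → A i ≠ default) (h2 : A (L - 1) = default) (h3 : A (R + 1) = default)
    (h4 : ∀ i, L ≤ i → i ≤ R → ((A i).org = true ↔ i = 0))
    (hLp : L ≤ p) (hpR : p ≤ R) (hL : L ≤ 0) (hR : 0 ≤ R) :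
    RW N ⟨Ctrl.aux AuxPh.resetL al, p - 1, A⟩ (3 * (R - L + 1).toNat + R.toNat + 3)
      ⟨Ctrl.aux AuxPh.incr al, 0, cleanA N A L (R - L + 1).toNat⟩ := by
  have s1 := resetL_walk al (p - L).toNat (p - 1) A
    (fun i hi hi' => h1 i (by omega) (by omega))
    (by rw [← h2]; congr 1; omega)
  have s2 := resetR_loop al (R - L + 1).toNat L A
    (fun i' hi hi' => h1 i' hi (by omega)) (by rw [← h3]; congr 1; omega)
  have s3 := home_walk al R.toNat (cleanA N A L (R - L + 1).toNat)
    (fun i hi hi' => by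
      rw [cleanA_org]
      have := h4 i (by omega) (by omega)
      simpa [show i ≠ 0 by omega] using this)
    (by rw [cleanA_org]; exact (h4 0 hL hR).2 rfl)
  have e12 : (⟨Ctrl.aux AuxPh.resetR al, p - 1 - ((p - L).toNat : ℕ) + 1, A⟩ : ACfg N) =
      ⟨Ctrl.aux AuxPh.resetR al, L, A⟩ := ACfg.mk_eq (by omega) rfl
  have e23 : (⟨Ctrl.aux AuxPh.home al, L + ((R - L + 1).toNat : ℕ) - 1,
      cleanA N A L (R - L + 1).toNat⟩ : ACfg N) =
      ⟨Ctrl.aux AuxPh.home al, (R.toNat : ℤ), cleanA N A L (R - L + 1).toNat⟩ :=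
    ACfg.mk_eq (by omega) rfl
  rw [e12] at s1; rw [e23] at s2
  refine ((s1.trans s2).trans s3).toRW.mono ?_
  omega

end Reset


/-! ### From the end of a branch to the counter: the reset preconditions hold -/

section AfterBranch

variable (N) in
/-- The tracks between two branches: input, master string and origin marker only. [folklore] -/
abbrev baseTracks (w : List α) (ms : List (Ch N)) : Tracks N :=
  ⟨strTrack w, strTrack ms, fun i => decide (i = 0), fun _ => none, fun _ => none, fun _ => false,
    fun _ => false⟩

/-- A cell all of whose tracks are empty is the blank cell. [folklore] -/
theorem toA_eq_default {t : Tracks N} {i : ℤ} (h1 : t.input i = none) (h2 : t.master i = none)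
    (h3 : t.org i = false) (h4 : t.sim i = none) (h5 : t.choice i = none) (h6 : t.hd i = false)
    (h7 : t.trail i = false) : toA t i = default := by
  simp only [toA, h1, h2, h3, h4, h5, h6, h7]; rfl

variable {w : List α} {ms : List (Ch N)} {p : ℤ} {σ : ℤ → Option N.Γ} {ws : List (Ch N)}
  {trl : ℤ → Bool} {lo hi : ℤ}

/-- No simulated symbol outside the trail interval. [folklore] -/
theorem Inv.sim_none (hI : Inv ms p σ ws trl lo hi) {i : ℤ} (h : i < lo ∨ hi < i) : σ i = none := by
  by_contra hc
  have := hI.sim_supp i hc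
  omega

/-- No trail bit outside the trail interval. [folklore] -/
theorem Inv.trl_false (hI : Inv ms p σ ws trl lo hi) {i : ℤ} (h : i < lo ∨ hi < i) :
    trl i = false := by
  cases ht : trl i
  · rfl
  · have := hI.trl_supp i ht; omega

variable (w) in
/-- The right end of the dirty interval at the end of a branch. [folklore] -/
def Inv.R (_hI : Inv ms p σ ws trl lo hi) : ℤ :=
  max hi (max (p + ws.length - 1) (max ((w.length : ℤ) - 1) ((ms.length : ℤ) - 1)))

/-- The right end of the dirty interval is at most `|ms| + |w|`. [folklore] -/
theorem Inv.R_le (hI : Inv ms p σ ws trl lo hi) : hI.R w ≤ ms.length + w.length := by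
  have := hI.tr_le; have := hI.p_le_tr; have := hI.le_tr
  simp only [Inv.R, max_le_iff]; omega

/-- The trail interval ends inside the dirty interval. [folklore] -/
theorem Inv.hi_le_R (hI : Inv ms p σ ws trl lo hi) : hi ≤ hI.R w := le_max_left _ _

/-- Outside the dirty interval the branch tracks agree with the base tracks, and inside it
cleaning produces the base tracks. [folklore] -/
theorem Inv.toA_eq_base (hI : Inv ms p σ ws trl lo hi) (i : ℤ) (h : i < lo ∨ hI.R w < i) :
    toA (simTracks N w ms σ p ws trl) i = toA (baseTracks N w ms) i := by
  have hR := hI.hi_le_R (w := w)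
  have h1 := hI.tl_le_p; have h2 := hI.p_le_tr
  have hout : i < lo ∨ hi < i := by omega
  have hc : strTrack ws (i - p) = none := by
    rcases h with h | h
    · exact strTrack_neg _ (by omega)
    · apply strTrack_of_length_le
      have : p + ws.length - 1 ≤ hI.R w := le_trans (le_max_left _ _) (le_max_right _ _)
      omega
  simp only [toA, hI.sim_none hout, hc, hI.trl_false hout, Cell.mk.injEq, true_and, and_true,
    decide_eq_false_iff_not]
  omega

/-- Every cell of the dirty interval is non-blank. [folklore] -/
theorem Inv.ne_default (hI : Inv ms p σ ws trl lo hi) (i : ℤ) (h1 : lo ≤ i) (h2 : i ≤ hI.R w) :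
    toA (simTracks N w ms σ p ws trl) i ≠ default := by
  intro heq
  have hp1 := hI.tl_le_p; have hp2 := hI.p_le_tr; have h0 := hI.le_tr
  by_cases hih : i ≤ hi
  · by_cases hip : i = p
    · have := congrArg Cell.hd heq
      simp [toA, hip] at this
    · have := congrArg Cell.trail heq
      simp [toA, hI.trl_of i h1 hih hip] at this
  · simp only [Inv.R, le_max_iff] at h2
    rcases h2 with h2 | h2 | h2 | h2
    · omega
    · have := congrArg Cell.choice heq
      simp only [toA, default_choice] at this
      exact strTrack_ne_none ws (i := i - p) (by omega) (by omega) this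
    · have := congrArg Cell.input heq
      simp only [toA, default_input] at this
      exact strTrack_ne_none w (i := i) (by omega) (by omega) this
    · have := congrArg Cell.master heq
      simp only [toA, default_master] at this
      exact strTrack_ne_none ms (i := i) (by omega) (by omega) this

/-- The cell left of the dirty interval is blank. [folklore] -/
theorem Inv.default_left (hI : Inv ms p σ ws trl lo hi) :
    toA (simTracks N w ms σ p ws trl) (lo - 1) = default := by
  have hp1 := hI.tl_le_p; have h0 := hI.tl_le
  refine toA_eq_default (strTrack_neg _ (by omega)) (strTrack_neg _ (by omega)) (by simp; omega)
    (hI.sim_none (Or.inl (by omega))) (strTrack_neg _ (by omega)) (by simp; omega)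
    (hI.trl_false (Or.inl (by omega)))

/-- The cell right of the dirty interval is blank. [folklore] -/
theorem Inv.default_right (hI : Inv ms p σ ws trl lo hi) :
    toA (simTracks N w ms σ p ws trl) (hI.R w + 1) = default := by
  have hp1 := hI.tl_le_p; have hp2 := hI.p_le_tr; have h0 := hI.le_tr
  have hR1 : hi ≤ hI.R w := hI.hi_le_R
  have hR2 : p + ws.length - 1 ≤ hI.R w := le_trans (le_max_left _ _) (le_max_right _ _)
  have hR3 : (w.length : ℤ) - 1 ≤ hI.R w :=
    le_trans (le_trans (le_max_left _ _) (le_max_right _ _)) (le_max_right _ _)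
  have hR4 : (ms.length : ℤ) - 1 ≤ hI.R w :=
    le_trans (le_trans (le_max_right _ _) (le_max_right _ _)) (le_max_right _ _)
  refine toA_eq_default (strTrack_of_length_le _ (by omega)) (strTrack_of_length_le _ (by omega))
    (by simp; omega) (hI.sim_none (Or.inr (by omega))) (strTrack_of_length_le _ (by omega))
    (by simp; omega) (hI.trl_false (Or.inr (by omega)))

/-- **After a branch**: the reset phase started one cell left of the simulated head ends at the
origin in phase `incr` with the base tracks restored. [folklore] -/
theorem Inv.reset_RW (hI : Inv ms p σ ws trl lo hi) (al : Bool) :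
    RW N ⟨Ctrl.aux AuxPh.resetL al, p - 1, toA (simTracks N w ms σ p ws trl)⟩
      (7 * ms.length + 4 * w.length + 6) ⟨Ctrl.aux AuxPh.incr al, 0, toA (baseTracks N w ms)⟩ := by
  have hp1 := hI.tl_le_p; have hp2 := hI.p_le_tr; have h0 := hI.le_tr; have h0' := hI.tl_le
  have hlo := hI.le_tl
  have hR1 : hi ≤ hI.R w := hI.hi_le_R
  have hRle := hI.R_le (w := w)
  have h := reset al (toA (simTracks N w ms σ p ws trl)) lo (hI.R w) p
    (fun i h1 h2 => hI.ne_default i h1 h2) hI.default_left hI.default_right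
    (fun i _ _ => by simp) hp1 (by omega) h0' (by omega)
  have hc : cleanA N (toA (simTracks N w ms σ p ws trl)) lo (hI.R w - lo + 1).toNat =
      toA (baseTracks N w ms) := by
    funext i
    simp only [cleanA]
    split_ifs with hh
    · rfl
    · exact hI.toA_eq_base i (by omega)
  rw [hc] at h
  exact h.mono (by omega)

end AfterBranch


/-! ### The counter: increment, copy, and back to the start of the next branch -/

section Counter

open scoped Classical in
variable (N) in
/-- Little-endian increment of an address string; `none` on overflow. [folklore] -/
noncomputable def incrList : List (Ch N) → Option (List (Ch N))
  | [] => none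
  | d :: ds => if IsMax N d then (incrList ds).map (dzero N :: ·) else some (dsucc N d :: ds)

variable (N) in
/-- The all-zero address string of length `k`. [folklore] -/
noncomputable def zeros (k : ℕ) : List (Ch N) := List.replicate k (dzero N)

/-- The all-zero string of length `k` has length `k`. [folklore] -/
@[simp] theorem zeros_length (k : ℕ) : (zeros N k).length = k := by simp [zeros]

/-- `zeros (k+1) = dzero :: zeros k`. [folklore] -/
theorem zeros_succ (k : ℕ) : zeros N (k + 1) = dzero N :: zeros N k := by
  simp [zeros, List.replicate_succ]

/-- `zeros (k+1) = zeros k ++ [dzero]`. [folklore] -/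
theorem zeros_succ' (k : ℕ) : zeros N (k + 1) = zeros N k ++ [dzero N] := by
  simp [zeros, List.replicate_succ']

/-- Incrementing preserves the length. [folklore] -/
theorem incrList_length {ms ms' : List (Ch N)} (h : incrList N ms = some ms') :
    ms'.length = ms.length := by
  induction ms generalizing ms' with
  | nil => simp [incrList] at h
  | cons d ds ih =>
    simp only [incrList] at h
    split_ifs at h with hd
    · cases h' : incrList N ds with
      | none => simp [h'] at h
      | some l => simp [h'] at h; subst h; simp [ih h']
    · simp at h; subst h; simp

/-- Appending a letter is writing it into the first cell past the string. [folklore] -/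
theorem strTrack_update_length {β : Type} (l : List β) (d : β) :
    Function.update (strTrack l) l.length (some d) = strTrack (l ++ [d]) := by
  funext j
  by_cases hj : j = l.length
  · subst hj
    rw [Function.update_self]
    induction l with
    | nil => simp
    | cons x l ih =>
      simp only [List.length_cons, List.cons_append]
      push_cast
      rw [strTrack_cons_succ _ _ _ (by positivity)]; exact ih
  · rw [Function.update_of_ne hj]
    induction l generalizing j with
    | nil =>
      simp only [List.length_nil, Nat.cast_zero] at hj
      simp only [strTrack_nil, List.nil_append]
      rw [strTrack]; rw [if_neg hj]
      split_ifs with h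
      · exact (strTrack_nil _).symm
      · rfl
    | cons x l ih =>
      simp only [List.cons_append]
      by_cases h0 : j = 0
      · subst h0; simp
      · by_cases hpos : 0 < j
        · rw [strTrack_cons_pos _ _ hpos, strTrack_cons_pos _ _ hpos]
          apply ih
          simp only [List.length_cons] at hj; push_cast at hj; omega
        · rw [strTrack_neg _ (by omega), strTrack_neg _ (by omega)]

variable (al : Bool)

/-- The increment loop. [folklore] -/
theorem incr_loop (ms : List (Ch N)) : ∀ (i : ℤ) (t : Tracks N),
    (∀ j, i ≤ j → t.master j = strTrack ms (j - i)) →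
    (∀ ms', incrList N ms = some ms' → ∃ m : ℕ, m ≤ ms.length ∧
      Rn N ⟨Ctrl.aux AuxPh.incr al, i, toA t⟩ (2 * m + 1)
        ⟨Ctrl.aux AuxPh.homeI al, i + m,
          toA { t with master := fun j => if i ≤ j then strTrack ms' (j - i) else t.master j }⟩) ∧
    (incrList N ms = none →
      Rn N ⟨Ctrl.aux AuxPh.incr al, i, toA t⟩ (2 * ms.length)
        ⟨Ctrl.aux AuxPh.incr al, i + ms.length,
          toA { t with master :=
            fun j => if i ≤ j then strTrack (zeros N ms.length) (j - i) else t.master j }⟩) := by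
  induction ms with
  | nil =>
    intro i t h
    refine ⟨fun ms' hm => by simp [incrList] at hm, fun _ => ?_⟩
    refine (Rn.refl _).cast ?_ (by simp)
    refine ACfg.mk_eq (by simp) ?_
    congr 1
    apply Tracks.ext <;> try rfl
    funext j
    dsimp only
    by_cases hj : i ≤ j
    · rw [if_pos hj, h j hj]; simp [zeros]
    · rw [if_neg hj]
  | cons d ds ih =>
    intro i t h
    have h0 : t.master i = some d := by rw [h i le_rfl]; simp
    by_cases hmax : IsMax N d
    · -- carry
      have e1 : astep N ⟨Ctrl.aux AuxPh.incr al, i, toA t⟩ =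
          some ⟨Ctrl.aux AuxPh.incr2 al, i,
            toA { t with master := Function.update t.master i (some (dzero N)) }⟩ := by
        simp [astep, tr, h0, hmax, update_toA]
      have e2 : astep N ⟨Ctrl.aux AuxPh.incr2 al, i,
            toA { t with master := Function.update t.master i (some (dzero N)) }⟩ =
          some ⟨Ctrl.aux AuxPh.incr al, i + 1,
            toA { t with master := Function.update t.master i (some (dzero N)) }⟩ := by
        simp [astep, tr]
      have ih' := ih (i + 1) { t with master := Function.update t.master i (some (dzero N)) }
        (by
          intro j hj
          simp only
          rw [Function.update_of_ne (by omega), h j (by omega), strTrack_cons_pos _ _ (by omega)]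
          congr 1; omega)
      have htr : ∀ l : List (Ch N),
          (fun j => if i + 1 ≤ j then strTrack l (j - (i + 1))
            else Function.update t.master i (some (dzero N)) j) =
          fun j => if i ≤ j then strTrack (dzero N :: l) (j - i) else t.master j := by
        intro l; funext j
        by_cases hj : i + 1 ≤ j
        · rw [if_pos hj, if_pos (by omega), strTrack_cons_pos _ _ (by omega)]; congr 1; omega
        · rw [if_neg hj]
          by_cases hji : j = i
          · subst hji; simp
          · rw [Function.update_of_ne hji, if_neg (by omega)]
      refine ⟨fun ms' hm => ?_, fun hm => ?_⟩
      · simp only [incrList, if_pos hmax] at hm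
        cases hds : incrList N ds with
        | none => simp [hds] at hm
        | some l =>
          simp only [hds, Option.map_some, Option.some.injEq] at hm
          subst hm
          obtain ⟨m, hm, hr⟩ := ih'.1 l hds
          refine ⟨m + 1, by simp only [List.length_cons]; omega, ?_⟩
          refine (Rn.step_trans e1 (Rn.step_trans e2 hr)).cast ?_ (by ring)
          refine ACfg.mk_eq (by push_cast; ring) ?_
          simp only [htr]
      · simp only [incrList, if_pos hmax] at hm
        cases hds : incrList N ds with
        | some l => simp [hds] at hm
        | none =>
          have hr := ih'.2 hds
          refine (Rn.step_trans e1 (Rn.step_trans e2 hr)).cast ?_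
            (by simp only [List.length_cons]; ring)
          refine ACfg.mk_eq (by simp only [List.length_cons]; push_cast; ring) ?_
          simp only [List.length_cons, zeros_succ, htr]
    · -- no carry
      have e1 : astep N ⟨Ctrl.aux AuxPh.incr al, i, toA t⟩ =
          some ⟨Ctrl.aux AuxPh.homeI al, i,
            toA { t with master := Function.update t.master i (some (dsucc N d)) }⟩ := by
        simp [astep, tr, h0, hmax, update_toA]
      refine ⟨fun ms' hm => ⟨0, by simp, ?_⟩, fun hm => by simp [incrList, hmax] at hm⟩
      simp only [incrList, if_neg hmax, Option.some.injEq] at hm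
      subst hm
      refine (Rn.one e1).cast ?_ rfl
      refine ACfg.mk_eq (by simp) ?_
      congr 1
      simp only [Tracks.mk.injEq, and_true, true_and]
      funext j
      by_cases hji : j = i
      · subst hji; simp
      · rw [Function.update_of_ne hji]
        by_cases hj : i ≤ j
        · rw [if_pos hj, h j hj, strTrack_cons_pos _ _ (by omega), strTrack_cons_pos _ _ (by omega)]
        · rw [if_neg hj]

/-- The copy loop: the master string is copied onto the (empty) working track. [folklore] -/
theorem copy_loop (ms : List (Ch N)) : ∀ (i : ℤ) (t : Tracks N),
    (∀ j, i ≤ j → t.master j = strTrack ms (j - i)) → (∀ j, i ≤ j → t.choice j = none) →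
    Rn N ⟨Ctrl.aux AuxPh.copy al, i, toA t⟩ (2 * ms.length)
      ⟨Ctrl.aux AuxPh.copy al, i + ms.length,
        toA { t with choice := fun j => if i ≤ j then strTrack ms (j - i) else t.choice j }⟩ := by
  induction ms with
  | nil =>
    intro i t _ hc
    refine (Rn.refl _).cast ?_ (by simp)
    refine ACfg.mk_eq (by simp) ?_
    congr 1
    apply Tracks.ext <;> try rfl
    funext j
    dsimp only
    by_cases hj : i ≤ j
    · rw [if_pos hj, hc j hj]; simp
    · rw [if_neg hj]
  | cons d ds ih =>
    intro i t h hc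
    have h0 : t.master i = some d := by rw [h i le_rfl]; simp
    have e1 : astep N ⟨Ctrl.aux AuxPh.copy al, i, toA t⟩ =
        some ⟨Ctrl.aux AuxPh.copy2 al, i,
          toA { t with choice := Function.update t.choice i (some d) }⟩ := by
      simp [astep, tr, h0, update_toA, update_eq_self_of_eq]
    have e2 : astep N ⟨Ctrl.aux AuxPh.copy2 al, i,
          toA { t with choice := Function.update t.choice i (some d) }⟩ =
        some ⟨Ctrl.aux AuxPh.copy al, i + 1,
          toA { t with choice := Function.update t.choice i (some d) }⟩ := by
      simp [astep, tr]
    have ih' := ih (i + 1) { t with choice := Function.update t.choice i (some d) }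
      (by
        intro j hj; simp only
        rw [h j (by omega), strTrack_cons_pos _ _ (by omega)]; congr 1; omega)
      (by intro j hj; simp only; rw [Function.update_of_ne (by omega), hc j (by omega)])
    refine (Rn.step_trans e1 (Rn.step_trans e2 ih')).cast ?_ (by simp only [List.length_cons]; ring)
    refine ACfg.mk_eq (by simp only [List.length_cons]; push_cast; ring) ?_
    congr 1
    simp only [Tracks.mk.injEq, and_true, true_and]
    funext j
    by_cases hj : i + 1 ≤ j
    · rw [if_pos hj, if_pos (by omega), strTrack_cons_pos _ _ (by omega)]; congr 1; omega
    · rw [if_neg hj]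
      by_cases hji : j = i
      · subst hji; simp
      · rw [Function.update_of_ne hji, if_neg (by omega)]

/-- Walking left to the origin marker (phase `homeI`). [folklore] -/
theorem homeI_walk (m : ℕ) (A : ℤ → Cell N) (h : ∀ i : ℤ, 0 < i → i ≤ m → (A i).org = false)
    (h0 : (A 0).org = true) :
    Rn N ⟨Ctrl.aux AuxPh.homeI al, m, A⟩ (m + 1) ⟨Ctrl.aux AuxPh.copy al, 0, A⟩ := by
  induction m with
  | zero =>
    exact Rn.one (by simp [astep, tr, h0])
  | succ m ih =>
    have hm : (A (m + 1)).org = false := h (m + 1) (by omega) (by push_cast; omega)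
    have e1 : astep N ⟨Ctrl.aux AuxPh.homeI al, m + 1, A⟩ =
        some ⟨Ctrl.aux AuxPh.homeI al, m, A⟩ := by
      simp [astep, tr, hm]
    push_cast
    exact Rn.step_trans e1 (ih fun i h1 h2 => h i h1 (by push_cast; omega))

/-- Walking left to the origin marker (phase `homeC`), then placing the simulated head.
[folklore] -/
theorem homeC_walk (m : ℕ) (A : ℤ → Cell N) (h : ∀ i : ℤ, 0 < i → i ≤ m → (A i).org = false)
    (h0 : (A 0).org = true) :
    Rn N ⟨Ctrl.aux AuxPh.homeC al, m, A⟩ (m + 1)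
      ⟨Ctrl.sim al default, 0, Function.update A 0 { A 0 with hd := true }⟩ := by
  induction m with
  | zero =>
    exact Rn.one (by simp [astep, tr, h0])
  | succ m ih =>
    have hm : (A (m + 1)).org = false := h (m + 1) (by omega) (by push_cast; omega)
    have e1 : astep N ⟨Ctrl.aux AuxPh.homeC al, m + 1, A⟩ =
        some ⟨Ctrl.aux AuxPh.homeC al, m, A⟩ := by
      simp [astep, tr, hm]
    push_cast
    exact Rn.step_trans e1 (ih fun i h1 h2 => h i h1 (by push_cast; omega))

end Counter


/-! ### One full iteration: branch, reset, increment, copy -/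

section Iteration

variable (N) in
/-- The tracks at the start of a branch for the address string `ms`. [folklore] -/
abbrev startTracks (w : List α) (ms : List (Ch N)) : Tracks N :=
  simTracks N w ms (fun _ => none) 0 ms (fun _ => false)

variable (N) in
/-- The configuration at the start of the branch for `ms` with alive flag `al`. [folklore] -/
def BS (w : List α) (al : Bool) (ms : List (Ch N)) : ACfg N :=
  ⟨Ctrl.sim al default, 0, toA (startTracks N w ms)⟩

variable (N) in
/-- The initial tracks: the input only. [folklore] -/
abbrev initTracks (w : List α) : Tracks N :=
  ⟨strTrack w, fun _ => none, fun _ => false, fun _ => none, fun _ => none, fun _ => false,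
    fun _ => false⟩

/-- Closed form of a bit track with a single bit set. [folklore] -/
theorem bitTrack_set (p : ℤ) :
    Function.update (fun _ : ℤ => false) p true = fun i => decide (i = p) := by
  funext i
  by_cases hi : i = p
  · subst hi; simp
  · rw [Function.update_of_ne hi]; simp [hi]

/-- Closed form of the working track after the copy loop. [folklore] -/
theorem chTrack_nonneg (ms : List (Ch N)) :
    (fun j : ℤ => if 0 ≤ j then strTrack ms (j - 0) else none) = fun j => strTrack ms (j - 0) := by
  funext j
  by_cases hj : 0 ≤ j
  · rw [if_pos hj]
  · rw [if_neg hj, strTrack_neg _ (by omega)]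

/-- Closed form of the master track after the increment loop. [folklore] -/
theorem masterTrack_nonneg (ms ms' : List (Ch N)) :
    (fun j : ℤ => if 0 ≤ j then strTrack ms' (j - 0) else strTrack ms j) = strTrack ms' := by
  funext j
  by_cases hj : 0 ≤ j
  · rw [if_pos hj, sub_zero]
  · rw [if_neg hj, strTrack_neg _ (by omega), strTrack_neg _ (by omega)]

variable (w : List α) (al : Bool)

/-- The very first step: mark the origin and the simulated head. [folklore] -/
theorem start_step : astep N ⟨Ctrl.start, 0, toA (initTracks N w)⟩ = some (BS N w false []) := by
  simp [astep, tr, BS, update_toA, bitTrack_set]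
  rfl

/-- From phase `copy` at the origin over the base tracks to the start of the branch. [folklore] -/
theorem copy_to_BS (ms : List (Ch N)) :
    Rn N ⟨Ctrl.aux AuxPh.copy al, 0, toA (baseTracks N w ms)⟩ (3 * ms.length + 2)
      (BS N w al ms) := by
  have s1 := copy_loop al ms 0 (baseTracks N w ms) (by intro j _; simp) (by intro j _; rfl)
  simp only [zero_add] at s1
  rw [chTrack_nonneg] at s1
  have e2 : astep N ⟨Ctrl.aux AuxPh.copy al, ms.length,
      toA { baseTracks N w ms with choice := fun j => strTrack ms (j - 0) }⟩ =
      some ⟨Ctrl.aux AuxPh.homeC al, ms.length,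
      toA { baseTracks N w ms with choice := fun j => strTrack ms (j - 0) }⟩ := by
    simp [astep, tr, strTrack_of_length_le, Function.update_eq_self]
  have s3 := homeC_walk al ms.length
    (toA { baseTracks N w ms with choice := fun j => strTrack ms (j - 0) })
    (fun i hi _ => by simp; omega) (by simp)
  refine (s1.trans (Rn.step_trans e2 s3)).cast ?_ (by ring)
  simp [BS, update_toA, update_eq_self_of_eq, bitTrack_set, startTracks, simTracks]

/-- A successful increment, then home. [folklore] -/
theorem incr_some (ms ms' : List (Ch N)) (h : incrList N ms = some ms') :
    RW N ⟨Ctrl.aux AuxPh.incr al, 0, toA (baseTracks N w ms)⟩ (3 * ms.length + 2)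
      ⟨Ctrl.aux AuxPh.copy al, 0, toA (baseTracks N w ms')⟩ := by
  obtain ⟨m, hm, s1⟩ := (incr_loop al ms 0 (baseTracks N w ms) (by intro j _; simp)).1 ms' h
  simp only [zero_add] at s1
  rw [masterTrack_nonneg] at s1
  have s2 := homeI_walk al m (toA (baseTracks N w ms')) (fun i hi _ => by simp; omega) (by simp)
  exact (s1.trans s2).toRW.mono (by omega)

/-- Overflow with the alive flag set: extend the string, clear the flag, then home. [folklore] -/
theorem incr_none_alive (ms : List (Ch N)) (h : incrList N ms = none) :
    RW N ⟨Ctrl.aux AuxPh.incr true, 0, toA (baseTracks N w ms)⟩ (3 * ms.length + 2)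
      ⟨Ctrl.aux AuxPh.copy false, 0, toA (baseTracks N w (zeros N (ms.length + 1)))⟩ := by
  have s1 := (incr_loop true ms 0 (baseTracks N w ms) (by intro j _; simp)).2 h
  simp only [zero_add] at s1
  rw [masterTrack_nonneg] at s1
  have e2 : astep N
      ⟨Ctrl.aux AuxPh.incr true, ms.length, toA (baseTracks N w (zeros N ms.length))⟩ =
      some ⟨Ctrl.aux AuxPh.homeI false, ms.length,
        toA (baseTracks N w (zeros N (ms.length + 1)))⟩ := by
    have hl : ((ms.length : ℕ) : ℤ) = ((zeros N ms.length).length : ℤ) := by simp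
    simp only [astep, tr, toA_master]
    rw [strTrack_of_length_le _ (by simp)]
    simp only [if_true, update_toA, toA_input, toA_org, toA_sim, toA_choice, toA_hd, toA_trail,
      Function.update_eq_self]
    rw [hl, strTrack_update_length, ← zeros_succ']
  have s3 := homeI_walk false ms.length (toA (baseTracks N w (zeros N (ms.length + 1))))
    (fun i hi _ => by simp; omega) (by simp)
  exact (s1.trans (Rn.step_trans e2 s3)).toRW.mono (by omega)

/-- Overflow with the alive flag clear: reject. [folklore] -/
theorem incr_none_dead (ms : List (Ch N)) (h : incrList N ms = none) :
    ∃ A : ℤ → Cell N, RW N ⟨Ctrl.aux AuxPh.incr false, 0, toA (baseTracks N w ms)⟩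
      (2 * ms.length + 1) ⟨Ctrl.rej, ms.length, A⟩ ∧ astep N ⟨Ctrl.rej, ms.length, A⟩ = none := by
  have s1 := (incr_loop false ms 0 (baseTracks N w ms) (by intro j _; simp)).2 h
  simp only [zero_add] at s1
  rw [masterTrack_nonneg] at s1
  have e2 : astep N
      ⟨Ctrl.aux AuxPh.incr false, ms.length, toA (baseTracks N w (zeros N ms.length))⟩ =
      some ⟨Ctrl.rej, ms.length, toA (baseTracks N w (zeros N ms.length))⟩ := by
    simp [astep, tr, strTrack_of_length_le, Function.update_eq_self]
  exact ⟨_, (s1.trans (Rn.one e2)).toRW, by simp [astep, tr]⟩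

/-- The step bound for one iteration on an address string of length `k` over an input of
length `n`. [folklore] -/
def Titer (k n : ℕ) : ℕ := 12 * k ^ 2 + 13 * k + 4 * n + 15

/-- **Iteration lemma.** [folklore] -/
theorem iteration (ms : List (Ch N)) :
    (runB N default 0 (S₀ N (strTrack w)) ms = Outcome.accept →
      ∃ (p' : ℤ) (A' : ℤ → Cell N),
        RW N (BS N w al ms) (Titer ms.length w.length) ⟨Ctrl.acc, p', A'⟩) ∧
    (runB N default 0 (S₀ N (strTrack w)) ms ≠ Outcome.accept →
      (∀ ms', incrList N ms = some ms' →
        RW N (BS N w al ms) (Titer ms.length w.length)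
          (BS N w (al || decide (runB N default 0 (S₀ N (strTrack w)) ms = Outcome.alive)) ms')) ∧
      (incrList N ms = none →
        (al || decide (runB N default 0 (S₀ N (strTrack w)) ms = Outcome.alive)) = true →
        RW N (BS N w al ms) (Titer ms.length w.length) (BS N w false (zeros N (ms.length + 1)))) ∧
      (incrList N ms = none →
        (al || decide (runB N default 0 (S₀ N (strTrack w)) ms = Outcome.alive)) = false →
        ∃ A' : ℤ → Cell N, RW N (BS N w al ms) (Titer ms.length w.length)
          ⟨Ctrl.rej, ms.length, A'⟩ ∧ astep N ⟨Ctrl.rej, ms.length, A'⟩ = none)) := by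
  have hS : Sof N (strTrack w) (fun _ => none) = S₀ N (strTrack w) := by funext i; simp [Sof]
  have hb := branch w ms al ms default 0 (fun _ => none) (fun _ => false) 0 0 Inv.start
  rw [hS] at hb
  refine ⟨fun ho => ?_, fun ho => ⟨fun ms' hi => ?_, fun hi hal => ?_, fun hi hal => ?_⟩⟩
  · obtain ⟨p', A', h⟩ := hb.1 ho
    exact ⟨p', A', h.mono (by unfold Titer; nlinarith)⟩
  · obtain ⟨p', σ', ws', trl', lo', hi', hI, h⟩ := hb.2 ho
    have h2 := hI.reset_RW (w := w)
      (al || decide (runB N default 0 (S₀ N (strTrack w)) ms = Outcome.alive))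
    have h3 := incr_some w (al || decide (runB N default 0 (S₀ N (strTrack w)) ms = Outcome.alive))
      ms ms' hi
    have h4 := (copy_to_BS w
      (al || decide (runB N default 0 (S₀ N (strTrack w)) ms = Outcome.alive)) ms').toRW
    have hl := incrList_length hi
    exact (((h.trans h2).trans h3).trans h4).mono (by unfold Titer; rw [hl]; nlinarith)
  · obtain ⟨p', σ', ws', trl', lo', hi', hI, h⟩ := hb.2 ho
    have h2 := hI.reset_RW (w := w)
      (al || decide (runB N default 0 (S₀ N (strTrack w)) ms = Outcome.alive))
    rw [hal] at h h2
    have h3 := incr_none_alive w ms hi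
    have h4 := (copy_to_BS w false (zeros N (ms.length + 1))).toRW
    refine (((h.trans h2).trans h3).trans h4).mono ?_
    simp only [zeros_length]; unfold Titer; nlinarith
  · obtain ⟨p', σ', ws', trl', lo', hi', hI, h⟩ := hb.2 ho
    have h2 := hI.reset_RW (w := w)
      (al || decide (runB N default 0 (S₀ N (strTrack w)) ms = Outcome.alive))
    rw [hal] at h h2
    obtain ⟨A', h3, hnone⟩ := incr_none_dead w ms hi
    exact ⟨A', ((h.trans h2).trans h3).mono (by unfold Titer; nlinarith), hnone⟩

end Iteration


/-! ### Enumerating the address strings of a given length in counter order -/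

section Enum

/-- The first digit has code `0`. [folklore] -/
theorem enc_dzero : enc N (dzero N) = ⟨0, cN_pos N⟩ := by simp [dzero]

/-- The digit with code `i` is the last digit iff `i + 1` is the number of digits. [folklore] -/
theorem isMax_iff (i : ℕ) (h : i < cN N) : IsMax N ((enc N).symm ⟨i, h⟩) ↔ i + 1 = cN N := by
  simp [IsMax]

/-- The successor of the digit with code `i` has code `i + 1`. [folklore] -/
theorem dsucc_eq (i : ℕ) (h : i + 1 < cN N) :
    dsucc N ((enc N).symm ⟨i, by omega⟩) = (enc N).symm ⟨i + 1, h⟩ := by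
  simp [dsucc, h]

variable (N) in
/-- The digits `i, i+1, …, cN - 1` in order. [folklore] -/
noncomputable def digs (i : ℕ) : List (Ch N) :=
  if h : i < cN N then (enc N).symm ⟨i, h⟩ :: digs (i + 1) else []
termination_by cN N - i

/-- No digits have code `≥ cN`. [folklore] -/
theorem digs_eq_nil {i : ℕ} (h : cN N ≤ i) : digs N i = [] := by
  rw [digs, dif_neg (by omega)]

/-- The digits from code `i` on: the digit with code `i`, then those from `i + 1`. [folklore] -/
theorem digs_eq_cons {i : ℕ} (h : i < cN N) : digs N i = (enc N).symm ⟨i, h⟩ :: digs N (i + 1) := by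
  rw [digs, dif_pos h]

/-- The digits in order start with `dzero`. [folklore] -/
theorem digs_zero : digs N 0 = dzero N :: digs N 1 := by
  rw [digs_eq_cons (cN_pos N)]; rfl

/-- There are `cN - i` digits with code `≥ i`. [folklore] -/
theorem digs_length : ∀ (m i : ℕ), cN N - i = m → (digs N i).length = m := by
  intro m
  induction m with
  | zero => intro i h; rw [digs_eq_nil (by omega)]; rfl
  | succ m ih => intro i h; rw [digs_eq_cons (by omega), List.length_cons, ih (i + 1) (by omega)]

/-- Every digit with code `≥ i` occurs among the digits from `i` on. [folklore] -/
theorem mem_digs : ∀ (m i : ℕ), cN N - i = m → ∀ (j : ℕ) (hj : j < cN N), i ≤ j →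
    (enc N).symm ⟨j, hj⟩ ∈ digs N i := by
  intro m
  induction m with
  | zero => intro i h j hj hij; omega
  | succ m ih =>
    intro i h j hj hij
    rw [digs_eq_cons (by omega)]
    by_cases hji : j = i
    · subst hji; exact List.mem_cons_self
    · exact List.mem_cons_of_mem _ (ih (i + 1) (by omega) j hj (by omega))

/-- Every digit occurs in the list of all digits. [folklore] -/
theorem mem_digs_zero (d : Ch N) : d ∈ digs N 0 := by
  have := mem_digs (cN N) 0 (by simp) (enc N d).val (enc N d).isLt (Nat.zero_le _)
  simpa using this

variable (N) in
/-- Consecutive strings are related by `incrList`, the last one incrementing to `fin`. [folklore] -/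
def ChainTo : List (Ch N) → List (List (Ch N)) → Option (List (Ch N)) → Prop
  | s, [], fin => incrList N s = fin
  | s, t :: rest, fin => incrList N s = some t ∧ ChainTo t rest fin

/-- Concatenation of counter chains. [folklore] -/
theorem chainTo_append {s t : List (Ch N)} {r₁ r₂ : List (List (Ch N))} {fin : Option (List (Ch N))}
    (h₁ : ChainTo N s r₁ (some t)) (h₂ : ChainTo N t r₂ fin) : ChainTo N s (r₁ ++ t :: r₂) fin := by
  induction r₁ generalizing s with
  | nil => exact ⟨h₁, h₂⟩
  | cons u r₁ ih => exact ⟨h₁.1, ih h₁.2⟩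

variable (N) in
/-- The block of strings with tail `t`, in counter order. [folklore] -/
noncomputable def block (t : List (Ch N)) : List (List (Ch N)) := (digs N 0).map (· :: t)

/-- A block starts with the string headed by `dzero`. [folklore] -/
theorem block_eq (t : List (Ch N)) : block N t = (dzero N :: t) :: (digs N 1).map (· :: t) := by
  rw [block, digs_zero, List.map_cons]

/-- Within a block the counter steps through the head digit, and at its end carries into the
tail. [folklore] -/
theorem block_chain (t : List (Ch N)) : ∀ (m i : ℕ) (h : i < cN N), cN N - i = m + 1 →
    ChainTo N ((enc N).symm ⟨i, h⟩ :: t) ((digs N (i + 1)).map (· :: t))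
      ((incrList N t).map (dzero N :: ·)) := by
  intro m
  induction m with
  | zero =>
    intro i h hm
    rw [digs_eq_nil (by omega), List.map_nil, ChainTo, incrList,
      if_pos ((isMax_iff i h).2 (by omega))]
  | succ m ih =>
    intro i h hm
    rw [digs_eq_cons (by omega), List.map_cons, ChainTo]
    refine ⟨?_, ih (i + 1) (by omega) (by omega)⟩
    rw [incrList, if_neg (by rw [isMax_iff]; omega), dsucc_eq i (by omega)]

variable (N) in
/-- All address strings of length `k`, in the order the counter produces them. [folklore] -/
noncomputable def enum : ℕ → List (List (Ch N))
  | 0 => [[]]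
  | k + 1 => (enum k).flatMap (block N)

/-- `enum k` consists of strings of length `k`. [folklore] -/
theorem length_of_mem_enum : ∀ (k : ℕ) (s : List (Ch N)), s ∈ enum N k → s.length = k := by
  intro k
  induction k with
  | zero => intro s hs; simp [enum] at hs; simp [hs]
  | succ k ih =>
    intro s hs
    simp only [enum, List.mem_flatMap, block, List.mem_map] at hs
    obtain ⟨t, ht, d, _, rfl⟩ := hs
    simp [ih t ht]

/-- Every string occurs in the enumeration of its length (completeness of the search). [folklore] -/
theorem mem_enum : ∀ (s : List (Ch N)), s ∈ enum N s.length := by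
  intro s
  induction s with
  | nil => simp [enum]
  | cons d t ih =>
    simp only [List.length_cons, enum, List.mem_flatMap, block, List.mem_map]
    exact ⟨t, ih, d, mem_digs_zero d, rfl⟩

/-- There are `cN ^ k` strings of length `k` in the enumeration. [folklore] -/
theorem enum_length (k : ℕ) : (enum N k).length = cN N ^ k := by
  induction k with
  | zero => rfl
  | succ k ih =>
    have hb : ∀ l : List (List (Ch N)), (l.flatMap (block N)).length = cN N * l.length := by
      intro l
      induction l with
      | nil => simp
      | cons t l ihl =>
        rw [List.flatMap_cons, List.length_append, ihl, block, List.length_map,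
          digs_length (cN N) 0 (by simp), List.length_cons]
        ring
    rw [enum, hb, ih, pow_succ]; ring

/-- Lifting a counter chain of tails to the counter chain of the blocks over them. [folklore] -/
theorem enum_chain_aux : ∀ (R : List (List (Ch N))) (s : List (Ch N)), ChainTo N s R none →
    ((s :: R).flatMap (block N)) = (dzero N :: s) :: ((s :: R).flatMap (block N)).tail ∧
    ChainTo N (dzero N :: s) ((s :: R).flatMap (block N)).tail none := by
  have hc : 0 < cN N := cN_pos N
  intro R
  induction R with
  | nil =>
    intro s hs
    simp only [List.flatMap_cons, List.flatMap_nil, List.append_nil, block_eq, List.tail_cons,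
      true_and]
    have := block_chain (t := s) (cN N - 1) 0 hc (by omega)
    rw [ChainTo] at hs
    rw [hs] at this
    simpa [dzero] using this
  | cons t R ih =>
    intro s hs
    obtain ⟨hst, htR⟩ := hs
    obtain ⟨ih1, ih2⟩ := ih t htR
    have hbc := block_chain (t := s) (cN N - 1) 0 hc (by omega)
    rw [hst] at hbc
    simp only [Option.map_some] at hbc
    have hd0 : (enc N).symm ⟨0, hc⟩ = dzero N := rfl
    rw [hd0] at hbc
    rw [List.flatMap_cons, block_eq]
    simp only [List.cons_append, List.tail_cons, true_and]
    rw [ih1]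
    exact chainTo_append hbc ih2

/-- `enum k` starts with the all-zero string and is a counter chain ending in overflow.
[folklore] -/
theorem enum_eq (k : ℕ) : enum N k = zeros N k :: (enum N k).tail ∧
    ChainTo N (zeros N k) (enum N k).tail none := by
  induction k with
  | zero => exact ⟨rfl, by simp [enum, ChainTo, incrList, zeros]⟩
  | succ k ih =>
    obtain ⟨h1, h2⟩ := ih
    have := enum_chain_aux (enum N k).tail (zeros N k) h2
    rw [← h1] at this
    rw [enum, zeros_succ]
    exact this

end Enum


/-! ### Rounds: all strings of one length, then all lengths -/

section Rounds

variable (N) in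
/-- The outcome of the branch addressed by `x` on input `w`. [folklore] -/
noncomputable def runB₀ (w : List α) (x : List (Ch N)) : Outcome :=
  runB N default 0 (S₀ N (strTrack w)) x

variable (N) in
/-- Some branch among `l` is still alive. [folklore] -/
noncomputable def anyAlive (w : List α) (l : List (List (Ch N))) : Bool :=
  l.any (fun x => decide (runB₀ N w x = Outcome.alive))

variable (w : List α)

/-- The iteration lemma, restated with `runB₀`. [folklore] -/
theorem iteration' (al : Bool) (s : List (Ch N)) (k : ℕ) (hs : s.length = k) :
    (runB₀ N w s = Outcome.accept → ∃ (p' : ℤ) (A' : ℤ → Cell N),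
      RW N (BS N w al s) (Titer k w.length) ⟨Ctrl.acc, p', A'⟩) ∧
    (runB₀ N w s ≠ Outcome.accept →
      (∀ ms', incrList N s = some ms' → RW N (BS N w al s) (Titer k w.length)
        (BS N w (al || decide (runB₀ N w s = Outcome.alive)) ms')) ∧
      (incrList N s = none → (al || decide (runB₀ N w s = Outcome.alive)) = true →
        RW N (BS N w al s) (Titer k w.length) (BS N w false (zeros N (k + 1)))) ∧
      (incrList N s = none → (al || decide (runB₀ N w s = Outcome.alive)) = false →
        ∃ A' : ℤ → Cell N, RW N (BS N w al s) (Titer k w.length) ⟨Ctrl.rej, k, A'⟩ ∧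
          astep N ⟨Ctrl.rej, k, A'⟩ = none)) := by
  subst hs; exact iteration w al s

/-- **Round lemma** along a counter chain. [folklore] -/
theorem round_chain (k : ℕ) : ∀ (rest : List (List (Ch N))) (s : List (Ch N)) (al : Bool),
    ChainTo N s rest none → (∀ x ∈ s :: rest, x.length = k) →
    ((∃ x ∈ s :: rest, runB₀ N w x = Outcome.accept) → ∃ (p' : ℤ) (A' : ℤ → Cell N),
      RW N (BS N w al s) ((rest.length + 1) * Titer k w.length) ⟨Ctrl.acc, p', A'⟩) ∧
    ((∀ x ∈ s :: rest, runB₀ N w x ≠ Outcome.accept) →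
      ((al || anyAlive N w (s :: rest)) = true →
        RW N (BS N w al s) ((rest.length + 1) * Titer k w.length)
          (BS N w false (zeros N (k + 1)))) ∧
      ((al || anyAlive N w (s :: rest)) = false → ∃ A' : ℤ → Cell N,
        RW N (BS N w al s) ((rest.length + 1) * Titer k w.length) ⟨Ctrl.rej, k, A'⟩ ∧
        astep N ⟨Ctrl.rej, k, A'⟩ = none)) := by
  intro rest
  induction rest with
  | nil =>
    intro s al hc hl
    have hs : s.length = k := hl s (by simp)
    have it := iteration' w al s k hs
    refine ⟨fun ⟨x, hx, hacc⟩ => ?_, fun hna => ?_⟩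
    · simp only [List.mem_singleton] at hx
      subst hx
      obtain ⟨p', A', h⟩ := it.1 hacc
      exact ⟨p', A', h.mono (by simp)⟩
    · have hs' : runB₀ N w s ≠ Outcome.accept := hna s (by simp)
      have hinc : incrList N s = none := hc
      have hb : (al || anyAlive N w [s]) = (al || decide (runB₀ N w s = Outcome.alive)) := by
        simp [anyAlive]
      rw [hb]
      refine ⟨fun hal => ?_, fun hal => ?_⟩
      · exact ((it.2 hs').2.1 hinc hal).mono (by simp)
      · obtain ⟨A', h, hn⟩ := (it.2 hs').2.2 hinc hal
        exact ⟨A', h.mono (by simp), hn⟩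
  | cons t rest ih =>
    intro s al hc hl
    have hs : s.length = k := hl s (by simp)
    have it := iteration' w al s k hs
    obtain ⟨hst, htr⟩ := hc
    have ih' := ih t (al || decide (runB₀ N w s = Outcome.alive)) htr
      (fun x hx => hl x (List.mem_cons_of_mem _ hx))
    have hB : Titer k w.length + (rest.length + 1) * Titer k w.length ≤
        ((t :: rest).length + 1) * Titer k w.length := by
      simp only [List.length_cons]; nlinarith
    refine ⟨fun ⟨x, hx, hacc⟩ => ?_, fun hna => ?_⟩
    · by_cases hsacc : runB₀ N w s = Outcome.accept
      · obtain ⟨p', A', h⟩ := it.1 hsacc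
        refine ⟨p', A', h.mono ?_⟩
        simp only [List.length_cons]; nlinarith [Nat.zero_le (Titer k w.length)]
      · have hx' : x ∈ t :: rest := by
          rcases List.mem_cons.1 hx with rfl | hx
          · exact (hsacc hacc).elim
          · exact hx
        have h1 := (it.2 hsacc).1 t hst
        obtain ⟨p', A', h2⟩ := ih'.1 ⟨x, hx', hacc⟩
        exact ⟨p', A', (h1.trans h2).mono hB⟩
    · have hsacc : runB₀ N w s ≠ Outcome.accept := hna s (by simp)
      have h1 := (it.2 hsacc).1 t hst
      have hb : (al || anyAlive N w (s :: t :: rest)) =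
          (al || decide (runB₀ N w s = Outcome.alive) || anyAlive N w (t :: rest)) := by
        simp [anyAlive, Bool.or_assoc]
      rw [hb]
      have ih2 := ih'.2 (fun x hx => hna x (List.mem_cons_of_mem _ hx))
      refine ⟨fun hal => ?_, fun hal => ?_⟩
      · exact (h1.trans (ih2.1 hal)).mono hB
      · obtain ⟨A', h2, hn⟩ := ih2.2 hal
        exact ⟨A', (h1.trans h2).mono hB, hn⟩

variable (N) in
/-- Some branch of depth `k` accepts. [folklore] -/
def AccAt (w : List α) (k : ℕ) : Prop := ∃ x ∈ enum N k, runB₀ N w x = Outcome.accept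

variable (N) in
/-- Some branch of depth `k` is still alive. [folklore] -/
def AliveAt (w : List α) (k : ℕ) : Prop := anyAlive N w (enum N k) = true

variable (N) in
/-- Step budget for the rounds `0, …, K-1` on an input of length `n`. [folklore] -/
noncomputable def budget (n : ℕ) : ℕ → ℕ
  | 0 => 0
  | K + 1 => budget n K + cN N ^ K * Titer K n

/-- All rounds below `K` pass without accepting, each with a surviving branch. [folklore] -/
theorem rounds_upto : ∀ K : ℕ, (∀ k < K, ¬AccAt N w k ∧ AliveAt N w k) →
    RW N (BS N w false []) (budget N w.length K) (BS N w false (zeros N K)) := by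
  intro K
  induction K with
  | zero => intro _; exact ⟨0, le_rfl, Rn.refl _⟩
  | succ K ih =>
    intro h
    have h1 := ih (fun k hk => h k (by omega))
    obtain ⟨hna, hal⟩ := h K (by omega)
    obtain ⟨he, hc⟩ := enum_eq (N := N) K
    have hr := round_chain w K (enum N K).tail (zeros N K) false hc
      (fun x hx => length_of_mem_enum K x (by rw [he]; exact hx))
    have hna' : ∀ x ∈ zeros N K :: (enum N K).tail, runB₀ N w x ≠ Outcome.accept := by
      intro x hx hacc; rw [← he] at hx; exact hna ⟨x, hx, hacc⟩
    have hal' : (false || anyAlive N w (zeros N K :: (enum N K).tail)) = true := by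
      rw [← he]; simpa [AliveAt] using hal
    have h2 := (hr.2 hna').1 hal'
    have hlen : (enum N K).tail.length + 1 = cN N ^ K := by
      have := enum_length (N := N) K
      rw [he, List.length_cons] at this; rw [← this]
    rw [hlen] at h2
    exact h1.trans h2

/-- The decisive round. [folklore] -/
theorem final_round (K : ℕ) (hK : AccAt N w K ∨ ¬AliveAt N w K)
    (hprev : ∀ k < K, ¬AccAt N w k ∧ AliveAt N w k) :
    ∃ x : ACfg N, RW N (BS N w false []) (budget N w.length (K + 1)) x ∧ astep N x = none ∧
      (x.q = Ctrl.acc ↔ AccAt N w K) := by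
  have h1 := rounds_upto w K hprev
  obtain ⟨he, hc⟩ := enum_eq (N := N) K
  have hr := round_chain w K (enum N K).tail (zeros N K) false hc
    (fun x hx => length_of_mem_enum K x (by rw [he]; exact hx))
  have hlen : (enum N K).tail.length + 1 = cN N ^ K := by
    have := enum_length (N := N) K
    rw [he, List.length_cons] at this; rw [← this]
  rw [hlen] at hr
  by_cases hacc : AccAt N w K
  · obtain ⟨x, hx, hxa⟩ := hacc
    obtain ⟨p', A', h2⟩ := hr.1 ⟨x, by rw [← he]; exact hx, hxa⟩
    exact ⟨_, h1.trans h2, by simp [astep, tr], by simp; exact ⟨x, hx, hxa⟩⟩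
  · have hna' : ∀ x ∈ zeros N K :: (enum N K).tail, runB₀ N w x ≠ Outcome.accept := by
      intro x hx hxa; rw [← he] at hx; exact hacc ⟨x, hx, hxa⟩
    have hal : ¬AliveAt N w K := hK.resolve_left hacc
    have hal' : (false || anyAlive N w (zeros N K :: (enum N K).tail)) = false := by
      rw [← he]; simpa [AliveAt] using hal
    obtain ⟨A', h2, hn⟩ := (hr.2 hna').2 hal'
    exact ⟨_, h1.trans h2, hn, by simp; exact hacc⟩

end Rounds


/-! ### The nondeterministic machine by absolute position, and its computation paths -/

section NGlue

/-- A configuration of `N` by absolute position. [folklore] -/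
structure NCfg (N : NTM α) where
  /-- state -/
  q : N.Λ
  /-- head position -/
  p : ℤ
  /-- tape -/
  S : ℤ → N.Γ

/-- The effect of a choice digit on an absolute configuration. [folklore] -/
def applyA : Ch N → NCfg N → NCfg N
  | (q', TM0.Stmt.write b), x => ⟨q', x.p, Function.update x.S x.p b⟩
  | (q', TM0.Stmt.move Dir.left), x => ⟨q', x.p - 1, x.S⟩
  | (q', TM0.Stmt.move Dir.right), x => ⟨q', x.p + 1, x.S⟩

/-- One step of `N` on absolute configurations. [folklore] -/
def AStep (x y : NCfg N) : Prop := ∃ d ∈ N.δ x.q (x.S x.p), y = applyA d x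

/-- Computation paths of `N` of length `n` (cons form). [folklore] -/
def APath : ℕ → NCfg N → NCfg N → Prop
  | 0, x, y => y = x
  | n + 1, x, z => ∃ y, AStep x y ∧ APath n y z

/-- Extending a computation path by one step at the end. [folklore] -/
theorem APath.snoc : ∀ (n : ℕ) (x y z : NCfg N), APath n x y → AStep y z → APath (n + 1) x z := by
  intro n
  induction n with
  | zero => intro x y z h1 h2; cases h1; exact ⟨z, h2, rfl⟩
  | succ n ih =>
    intro x y z h1 h2
    obtain ⟨x', hx, hp⟩ := h1
    exact ⟨x', hx, ih x' y z hp h2⟩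

/-- `N.ReachesIn` in cons form. [folklore] -/
theorem reachesIn_cons : ∀ (n : ℕ) (c c₁ c' : N.Cfg), N.Step c c₁ → N.ReachesIn n c₁ c' →
    N.ReachesIn (n + 1) c c' := by
  intro n
  induction n with
  | zero => intro c c₁ c' h1 h2; cases h2; exact ⟨c, rfl, h1⟩
  | succ n ih =>
    intro c c₁ c' h1 h2
    obtain ⟨c₂, h2, h3⟩ := h2
    exact ⟨c₂, ih c c₁ c₂ h1 h2, h3⟩

/-- `c` is the configuration `x` seen from the head. [folklore] -/
def NRepr (c : N.Cfg) (x : NCfg N) : Prop := c.q = x.q ∧ ∀ i, c.Tape.nth i = x.S (x.p + i)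

/-- Applying a choice digit concretely and abstractly gives corresponding configurations.
[folklore] -/
theorem nrepr_applyA {c : N.Cfg} {x : NCfg N} (h : NRepr c x) (d : Ch N) :
    NRepr ⟨d.1, applyStmt d.2 c.Tape⟩ (applyA d x) := by
  obtain ⟨q', (_ | _) | b⟩ := d
  · refine ⟨rfl, fun i => ?_⟩
    simp only [applyStmt, applyA, Tape.move_left_nth, h.2 (i - 1)]
    congr 1; ring
  · refine ⟨rfl, fun i => ?_⟩
    simp only [applyStmt, applyA, Tape.move_right_nth, h.2 (i + 1)]
    congr 1; ring
  · refine ⟨rfl, fun i => ?_⟩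
    simp only [applyStmt, applyA, Tape.write_nth]
    by_cases hi : i = 0
    · subst hi; simp
    · rw [if_neg hi, Function.update_of_ne (by omega), h.2 i]

/-- A concrete step of `N` is an abstract step. [folklore] -/
theorem nrepr_step {c c' : N.Cfg} {x : NCfg N} (h : NRepr c x) (hs : N.Step c c') :
    ∃ y, AStep x y ∧ NRepr c' y := by
  obtain ⟨d, hd, rfl⟩ := hs
  have hhead : c.Tape.head = x.S x.p := by
    have := h.2 0; simpa using this
  rw [h.1, hhead] at hd
  exact ⟨applyA d x, ⟨d, hd, rfl⟩, nrepr_applyA h d⟩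

/-- An abstract step of `N` is a concrete step. [folklore] -/
theorem nrepr_astep {c : N.Cfg} {x y : NCfg N} (h : NRepr c x) (hs : AStep x y) :
    ∃ c', N.Step c c' ∧ NRepr c' y := by
  obtain ⟨d, hd, rfl⟩ := hs
  have hhead : c.Tape.head = x.S x.p := by
    have := h.2 0; simpa using this
  refine ⟨⟨d.1, applyStmt d.2 c.Tape⟩, ⟨d, by rw [h.1, hhead]; exact hd, rfl⟩, nrepr_applyA h d⟩

/-- Concrete computation branches of `N` are abstract computation paths. [folklore] -/
theorem nrepr_reachesIn : ∀ (n : ℕ) (c c' : N.Cfg) (x : NCfg N), NRepr c x → N.ReachesIn n c c' →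
    ∃ y, APath n x y ∧ NRepr c' y := by
  intro n
  induction n with
  | zero => intro c c' x h h2; cases h2; exact ⟨x, rfl, h⟩
  | succ n ih =>
    intro c c'' x h h2
    obtain ⟨c', h2, h3⟩ := h2
    obtain ⟨y, hp, hy⟩ := ih c c' x h h2
    obtain ⟨z, hz, hz'⟩ := nrepr_step hy h3
    exact ⟨z, APath.snoc n x y z hp hz, hz'⟩

/-- Abstract computation paths of `N` are concrete computation branches. [folklore] -/
theorem nrepr_apath : ∀ (n : ℕ) (c : N.Cfg) (x y : NCfg N), NRepr c x → APath n x y →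
    ∃ c', N.ReachesIn n c c' ∧ NRepr c' y := by
  intro n
  induction n with
  | zero => intro c x y h h2; cases h2; exact ⟨c, rfl, h⟩
  | succ n ih =>
    intro c x z h h2
    obtain ⟨y, hy, hp⟩ := h2
    obtain ⟨c₁, hs, h₁⟩ := nrepr_astep h hy
    obtain ⟨c', hr, h'⟩ := ih c₁ y z h₁ hp
    exact ⟨c', reachesIn_cons n c c₁ c' hs hr, h'⟩

/-! Relating `runB` to computation paths. -/

/-- Following a valid digit from a non-accepting state. [folklore] -/
theorem runB_cons_of_mem {q : N.Λ} {p : ℤ} {S : ℤ → N.Γ} {d : Ch N} {ds : List (Ch N)}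
    (hq : q ≠ N.accept) (hd : d ∈ N.δ q (S p)) :
    runB N q p S (d :: ds) =
      runB N (applyA d ⟨q, p, S⟩).q (applyA d ⟨q, p, S⟩).p (applyA d ⟨q, p, S⟩).S ds := by
  obtain ⟨q', (_ | _) | b⟩ := d <;> simp [runB, hq, hd, applyA]

/-- An invalid digit kills the branch. [folklore] -/
theorem runB_cons_of_not_mem {q : N.Λ} {p : ℤ} {S : ℤ → N.Γ} {d : Ch N} {ds : List (Ch N)}
    (hq : q ≠ N.accept) (hd : d ∉ N.δ q (S p)) : runB N q p S (d :: ds) = Outcome.dead := by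
  obtain ⟨q', (_ | _) | b⟩ := d <;> simp [runB, hq, hd]

/-- From the accepting state every address string accepts. [folklore] -/
theorem runB_of_accept {q : N.Λ} {p : ℤ} {S : ℤ → N.Γ} (ds : List (Ch N)) (hq : q = N.accept) :
    runB N q p S ds = Outcome.accept := by
  cases ds with
  | nil => simp [runB, hq]
  | cons d ds => obtain ⟨q', (_ | _) | b⟩ := d <;> simp [runB, hq]

/-- An accepting address string yields a computation path to the accepting state. [folklore] -/
theorem apath_of_runB_accept : ∀ (ds : List (Ch N)) (x : NCfg N),
    runB N x.q x.p x.S ds = Outcome.accept →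
    ∃ m ≤ ds.length, ∃ y, APath m x y ∧ y.q = N.accept := by
  intro ds
  induction ds with
  | nil =>
    intro x h
    refine ⟨0, le_rfl, x, rfl, ?_⟩
    by_contra hq
    simp [runB, hq] at h
    split_ifs at h
  | cons d ds ih =>
    intro x h
    by_cases hq : x.q = N.accept
    · exact ⟨0, by simp, x, rfl, hq⟩
    · by_cases hd : d ∈ N.δ x.q (x.S x.p)
      · rw [runB_cons_of_mem hq hd] at h
        obtain ⟨m, hm, y, hp, hy⟩ := ih (applyA d ⟨x.q, x.p, x.S⟩) h
        exact ⟨m + 1, by simp only [List.length_cons]; omega, y, ⟨_, ⟨d, hd, rfl⟩, hp⟩, hy⟩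
      · rw [runB_cons_of_not_mem hq hd] at h; cases h

/-- An alive address string of length `k` yields a computation path of length `k + 1`. [folklore] -/
theorem apath_of_runB_alive : ∀ (ds : List (Ch N)) (x : NCfg N),
    runB N x.q x.p x.S ds = Outcome.alive → ∃ y, APath (ds.length + 1) x y := by
  intro ds
  induction ds with
  | nil =>
    intro x h
    by_cases hq : x.q = N.accept
    · simp [runB, hq] at h
    · by_cases hne : (N.δ x.q (x.S x.p)).Nonempty
      · obtain ⟨d, hd⟩ := hne
        exact ⟨applyA d x, applyA d x, ⟨d, hd, rfl⟩, rfl⟩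
      · simp [runB, hq, hne] at h
  | cons d ds ih =>
    intro x h
    by_cases hq : x.q = N.accept
    · rw [runB_of_accept _ hq] at h; cases h
    · by_cases hd : d ∈ N.δ x.q (x.S x.p)
      · rw [runB_cons_of_mem hq hd] at h
        obtain ⟨y, hp⟩ := ih (applyA d ⟨x.q, x.p, x.S⟩) h
        exact ⟨y, _, ⟨d, hd, rfl⟩, hp⟩
      · rw [runB_cons_of_not_mem hq hd] at h; cases h

/-- A computation path to the accepting state yields an accepting address string of the same
length. [folklore] -/
theorem runB_accept_of_apath : ∀ (m : ℕ) (x y : NCfg N), APath m x y → y.q = N.accept →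
    ∃ ds : List (Ch N), ds.length = m ∧ runB N x.q x.p x.S ds = Outcome.accept := by
  intro m
  induction m with
  | zero =>
    intro x y h hy
    cases h
    exact ⟨[], rfl, by simp [runB, hy]⟩
  | succ m ih =>
    intro x z h hz
    obtain ⟨y, ⟨d, hd, rfl⟩, hp⟩ := h
    obtain ⟨ds, hlen, hacc⟩ := ih _ z hp hz
    refine ⟨d :: ds, by simp [hlen], ?_⟩
    by_cases hq : x.q = N.accept
    · exact runB_of_accept _ hq
    · rw [runB_cons_of_mem hq hd]; exact hacc

/-- Prefixes of an accepting address string accept or are alive. [folklore] -/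
theorem runB_take_of_accept : ∀ (ds : List (Ch N)) (x : NCfg N),
    runB N x.q x.p x.S ds = Outcome.accept → ∀ j : ℕ,
    runB N x.q x.p x.S (ds.take j) = Outcome.accept ∨
      runB N x.q x.p x.S (ds.take j) = Outcome.alive := by
  intro ds
  induction ds with
  | nil => intro x h j; left; simpa using h
  | cons d ds ih =>
    intro x h j
    by_cases hq : x.q = N.accept
    · left; exact runB_of_accept _ hq
    · by_cases hd : d ∈ N.δ x.q (x.S x.p)
      · cases j with
        | zero =>
          right
          simp only [List.take_zero, runB, if_neg hq]
          rw [if_pos ⟨d, hd⟩]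
        | succ j =>
          rw [List.take_succ_cons, runB_cons_of_mem hq hd]
          rw [runB_cons_of_mem hq hd] at h
          exact ih _ h j
      · rw [runB_cons_of_not_mem hq hd] at h; cases h

/-! The start configuration. -/

/-- `strTrack` is list indexing on nonnegative cells. [folklore] -/
theorem strTrack_eq_getElem? {β : Type} (l : List β) {i : ℤ} (hi : 0 ≤ i) :
    strTrack l i = l[i.toNat]? := by
  induction l generalizing i with
  | nil => simp
  | cons d l ih =>
    by_cases h0 : i = 0
    · subst h0; simp
    · rw [strTrack_cons_pos _ _ (by omega), ih (by omega)]
      have : i.toNat = (i - 1).toNat + 1 := by omega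
      rw [this, List.getElem?_cons_succ]

/-- The cells of the initial tape `Tape.mk₁ (w.map f)` by absolute position. [folklore] -/
theorem mk₁_map_nth {Γ : Type} [Inhabited Γ] (f : α → Γ) (w : List α) (i : ℤ) :
    (Tape.mk₁ (w.map f)).nth i = (match strTrack w i with | some a => f a | none => default) := by
  rcases le_or_gt 0 i with hi | hi
  · obtain ⟨m, rfl⟩ := Int.eq_ofNat_of_zero_le hi
    rw [Tape.mk₁, Tape.mk₂, Tape.mk'_nth_nat, ListBlank.nth_mk, strTrack_eq_getElem? _ hi,
      Int.toNat_natCast, List.getI_eq_getElem?_getD, List.getElem?_map]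
    cases w[m]? <;> rfl
  · obtain ⟨m, rfl⟩ := Int.exists_eq_neg_ofNat (le_of_lt hi)
    cases m with
    | zero => simp at hi
    | succ m =>
      rw [strTrack_neg _ hi]
      rfl

/-- The start configuration of `N` on `w` is represented by `(q₀, 0, S₀)`. [folklore] -/
theorem nrepr_init (w : List α) : NRepr (N.init w) ⟨default, 0, S₀ N (strTrack w)⟩ := by
  refine ⟨rfl, fun i => ?_⟩
  simp only [NTM.init, TM0.init, zero_add, S₀]
  rw [mk₁_map_nth]

/-! Consequences for the rounds. -/

variable (w : List α) {f : ℕ → ℕ}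

/-- If `N` accepts `w` within its time bound `f`, some branch of depth `≤ f |w|` accepts.
[folklore] -/
theorem accAt_of_accepts (hN : N.RunsInTime f) (h : N.Accepts w) :
    ∃ k ≤ f w.length, AccAt N w k := by
  obtain ⟨m, c, hr, hc⟩ := h
  have hm : m ≤ f w.length := hN w m c hr
  obtain ⟨y, hp, hy⟩ := nrepr_reachesIn m _ _ _ (nrepr_init w) hr
  obtain ⟨ds, hlen, hacc⟩ := runB_accept_of_apath m _ y hp (by rw [← hy.1]; exact hc)
  have hmem := mem_enum (N := N) ds
  rw [hlen] at hmem
  exact ⟨m, hm, ds, hmem, hacc⟩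

/-- If some branch accepts then `N` accepts. [folklore] -/
theorem accepts_of_accAt {k : ℕ} (h : AccAt N w k) : N.Accepts w := by
  obtain ⟨x, _, hacc⟩ := h
  obtain ⟨m, _, y, hp, hy⟩ := apath_of_runB_accept x ⟨default, 0, S₀ N (strTrack w)⟩ hacc
  obtain ⟨c', hr, hc'⟩ := nrepr_apath m _ _ y (nrepr_init w) hp
  exact ⟨m, c', hr, by rw [hc'.1]; exact hy⟩

/-- A branch alive at depth `k` gives a computation branch of length `k + 1`, so `k < f |w|`.
[folklore] -/
theorem lt_of_aliveAt (hN : N.RunsInTime f) {k : ℕ} (h : AliveAt N w k) : k < f w.length := by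
  obtain ⟨x, hx, hal⟩ := List.any_eq_true.1 h
  have hlen := length_of_mem_enum k x hx
  have hal' : runB₀ N w x = Outcome.alive := of_decide_eq_true hal
  obtain ⟨y, hp⟩ := apath_of_runB_alive x ⟨default, 0, S₀ N (strTrack w)⟩ hal'
  obtain ⟨c', hr, _⟩ := nrepr_apath _ _ _ y (nrepr_init w) hp
  have := hN w _ c' hr
  omega

/-- Below an accepting depth every depth accepts or is alive. [folklore] -/
theorem accAt_or_aliveAt_of_accAt {k j : ℕ} (h : AccAt N w k) (hj : j ≤ k) :
    AccAt N w j ∨ AliveAt N w j := by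
  obtain ⟨x, hx, hacc⟩ := h
  have hlen := length_of_mem_enum k x hx
  have hlen' : (x.take j).length = j := by simp [hlen, hj]
  have hmem := mem_enum (N := N) (x.take j)
  rw [hlen'] at hmem
  rcases runB_take_of_accept x ⟨default, 0, S₀ N (strTrack w)⟩ hacc j with h | h
  · exact Or.inl ⟨x.take j, hmem, h⟩
  · exact Or.inr (List.any_eq_true.2 ⟨x.take j, hmem, decide_eq_true h⟩)

open scoped Classical in
/-- **The simulator is correct and fast**: from the start configuration it halts within the
budget of `K + 1 ≤ t(n) + 1` rounds, accepting iff `N` accepts. [folklore] -/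
theorem sim_spec (hN : N.RunsInTime f) :
    ∃ (x : ACfg N) (K : ℕ), K ≤ f w.length ∧
      RW N ⟨Ctrl.start, 0, toA (initTracks N w)⟩ (1 + budget N w.length (K + 1)) x ∧
      astep N x = none ∧ (x.q = Ctrl.acc ↔ N.Accepts w) := by
  have hex : ∃ k, AccAt N w k ∨ ¬AliveAt N w k :=
    ⟨f w.length, Or.inr fun h => lt_irrefl _ (lt_of_aliveAt w hN h)⟩
  let K := Nat.find hex
  have hK : AccAt N w K ∨ ¬AliveAt N w K := Nat.find_spec hex
  have hprev : ∀ k < K, ¬AccAt N w k ∧ AliveAt N w k := by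
    intro k hk
    have := Nat.find_min hex hk
    tauto
  have hKle : K ≤ f w.length :=
    Nat.find_min' hex (Or.inr fun h => lt_irrefl _ (lt_of_aliveAt w hN h))
  obtain ⟨x, hx, hnone, hiff⟩ := final_round w K hK hprev
  refine ⟨x, K, hKle, (Rn.one (start_step w)).toRW.trans hx, hnone, hiff.trans ⟨?_, ?_⟩⟩
  · exact accepts_of_accAt w
  · intro hacc
    obtain ⟨k, _, hk⟩ := accAt_of_accepts w hN hacc
    by_cases hkK : k < K
    · exact ((hprev k hkK).1 hk).elim
    · rcases accAt_or_aliveAt_of_accAt w hk (show K ≤ k by omega) with h | h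
      · exact h
      · exact hK.resolve_right (not_not.2 h)

end NGlue


/-! ### The simulator as a `TM`, and the transfer of the abstract run -/

section Transfer

variable [Fintype α]

variable (N) in
/-- **The deterministic single-tape simulator of `N`** as a Sipser machine. [folklore] -/
noncomputable def simTM : TM α where
  Γ := Cell N
  Λ := Ctrl N
  inp := fun a => { (default : Cell N) with input := some a }
  inp_injective := by intro a b h; simpa using congrArg Cell.input h
  inp_ne_blank := by intro a h; have := congrArg Cell.input h; simp at this
  M := tr N
  accept := Ctrl.acc
  accept_halts := fun _ => rfl

/-- A concrete configuration of the simulator represents an abstract one. [folklore] -/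
def CRepr (c : (simTM N).Cfg) (x : ACfg N) : Prop := c.q = x.q ∧ ∀ i, c.Tape.nth i = x.A (x.p + i)

/-- One step of the concrete simulator is one step of the abstract one. [folklore] -/
theorem step_repr {c : (simTM N).Cfg} {x : ACfg N} (h : CRepr c x) :
    (astep N x = none → (simTM N).step c = none) ∧
    (∀ y, astep N x = some y → ∃ c', (simTM N).step c = some c' ∧ CRepr c' y) := by
  obtain ⟨q, T⟩ := c
  obtain ⟨hq, hT⟩ := h
  simp only at hq
  subst hq
  have h0 : T.head = x.A x.p := by have := hT 0; simpa using this
  have hM : (simTM N).step = TM0.step (tr N) := rfl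
  rw [hM]
  constructor
  · intro hn
    simp only [astep] at hn
    split at hn <;> simp_all [TM0.step]; rfl
  · intro y hy
    simp only [astep] at hy
    split at hy
    · cases hy
    · rename_i q' heq
      cases hy
      refine ⟨⟨q', T.move Dir.left⟩, by simp [TM0.step, h0, heq]; rfl, rfl, fun i => ?_⟩
      simp only [Tape.move_left_nth, hT (i - 1)]
      congr 1; ring
    · rename_i q' heq
      cases hy
      refine ⟨⟨q', T.move Dir.right⟩, by simp [TM0.step, h0, heq]; rfl, rfl, fun i => ?_⟩
      simp only [Tape.move_right_nth, hT (i + 1)]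
      congr 1; ring
    · rename_i q' s' heq
      cases hy
      refine ⟨⟨q', T.write s'⟩, by simp [TM0.step, h0, heq]; rfl, rfl, fun i => ?_⟩
      simp only [Tape.write_nth]
      by_cases hi : i = 0
      · subst hi; simp
      · rw [if_neg hi, Function.update_of_ne (by omega), hT i]

/-- `n` steps of the concrete simulator are `n` steps of the abstract one. [folklore] -/
theorem run_repr : ∀ (n : ℕ) (c : (simTM N).Cfg) (x y : ACfg N), CRepr c x → run N n x = some y →
    ∃ c', (flip bind (simTM N).step)^[n] (some c) = some c' ∧ CRepr c' y := by
  intro n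
  induction n with
  | zero =>
    intro c x y h hr
    simp only [run_zero, Option.some.injEq] at hr
    subst hr
    exact ⟨c, rfl, h⟩
  | succ n ih =>
    intro c x y h hr
    rw [run_succ] at hr
    cases hx : astep N x with
    | none => rw [hx] at hr; cases hr
    | some x₁ =>
      rw [hx] at hr
      obtain ⟨c₁, hc₁, h₁⟩ := (step_repr h).2 x₁ hx
      obtain ⟨c', hc', h'⟩ := ih c₁ x₁ y h₁ hr
      refine ⟨c', ?_, h'⟩
      rw [Function.iterate_succ_apply]
      simpa [flip, hc₁] using hc'

/-- The start configuration of the simulator on `w` is represented by the initial tracks.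
[folklore] -/
theorem init_repr (w : List α) :
    CRepr ((simTM N).init w) ⟨Ctrl.start, 0, toA (initTracks N w)⟩ := by
  refine ⟨rfl, fun i => ?_⟩
  simp only [TM.init, TM0.init, zero_add]
  rw [show (simTM N).inp = fun a => { (default : Cell N) with input := some a } from rfl,
    mk₁_map_nth]
  show _ = (⟨strTrack w i, none, false, none, none, false, false⟩ : Cell N)
  cases strTrack w i <;> rfl

/-- **Transfer.** The simulator halts on `w` within `1 + budget (K+1)` steps for some
`K ≤ f |w|`, and accepts iff `N` accepts. [folklore] -/
theorem simTM_spec (w : List α) {f : ℕ → ℕ} (hN : N.RunsInTime f) :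
    ∃ K ≤ f w.length, (simTM N).HaltsWithin w (1 + budget N w.length (K + 1)) ∧
      ((simTM N).Accepts w ↔ N.Accepts w) := by
  obtain ⟨x, K, hK, ⟨n, hn, hr⟩, hnone, hiff⟩ := sim_spec w hN
  obtain ⟨c', hc', hrep⟩ := run_repr n _ _ x (init_repr w) hr
  have hhalt : (simTM N).step c' = none := (step_repr hrep).1 hnone
  refine ⟨K, hK, ⟨c', ⟨⟨⟨n, hc'⟩, hn⟩⟩, hhalt⟩, ?_⟩
  have hmem : c' ∈ StateTransition.eval (simTM N).step ((simTM N).init w) :=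
    StateTransition.mem_eval.2 ⟨reaches_of_iterate_eq_some _ _ n c' hc', hhalt⟩
  rw [← hiff, ← hrep.1]
  constructor
  · rintro ⟨c, hc, hcq⟩
    rw [← Part.mem_unique hc hmem]; exact hcq
  · intro h; exact ⟨c', hmem, h⟩

end Transfer


/-! ### The time bound -/

section Final

/-- The iteration bound is monotone in the string length. [folklore] -/
theorem Titer_mono {k k' : ℕ} (h : k ≤ k') (n : ℕ) : Titer k n ≤ Titer k' n := by
  unfold Titer
  have : k ^ 2 ≤ k' ^ 2 := Nat.pow_le_pow_left h 2
  omega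

/-- The budget is monotone in the number of rounds. [folklore] -/
theorem budget_mono (n : ℕ) {K K' : ℕ} (h : K ≤ K') : budget N n K ≤ budget N n K' := by
  induction h with
  | refl => exact le_rfl
  | step _ ih => exact ih.trans (by simp [budget])

/-- `budget n K ≤ K · cN^K · Titer K n`. [folklore] -/
theorem budget_le (n K : ℕ) : budget N n K ≤ K * cN N ^ K * Titer K n := by
  have hc : 1 ≤ cN N := cN_pos N
  induction K with
  | zero => simp [budget]
  | succ K ih =>
    have h1 : cN N ^ K ≤ cN N ^ (K + 1) := Nat.pow_le_pow_right hc (by omega)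
    have h2 : Titer K n ≤ Titer (K + 1) n := Titer_mono (by omega) n
    calc budget N n (K + 1) = budget N n K + cN N ^ K * Titer K n := rfl
      _ ≤ K * cN N ^ K * Titer K n + cN N ^ K * Titer K n := by omega
      _ = (K + 1) * (cN N ^ K * Titer K n) := by ring
      _ ≤ (K + 1) * (cN N ^ (K + 1) * Titer (K + 1) n) :=
        Nat.mul_le_mul_left _ (Nat.mul_le_mul h1 h2)
      _ = (K + 1) * cN N ^ (K + 1) * Titer (K + 1) n := by ring

variable (N) in
/-- The running time bound of the simulator in terms of the time bound `f` of `N`. [folklore] -/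
noncomputable def gbound (f : ℕ → ℕ) (n : ℕ) : ℕ := 1 + budget N n (f n + 1)

/-- The running time bound is `2^{O(f n + n)}`: `gbound f n ≤ 45 · 2^{(3 + cN)(f n + n + 2)}`.
[folklore] -/
theorem gbound_le (f : ℕ → ℕ) (n : ℕ) :
    gbound N f n ≤ 45 * 2 ^ ((3 + cN N) * (f n + n + 2)) := by
  have hc : 1 ≤ cN N := cN_pos N
  have hK : budget N n (f n + 1) ≤ (f n + 1) * cN N ^ (f n + 1) * Titer (f n + 1) n := budget_le _ _
  -- abbreviations
  generalize hD : f n + n + 2 = D at *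
  have hKD : f n + 1 ≤ D := by omega
  have hnD : n ≤ D := by omega
  have hD1 : 1 ≤ D := by omega
  have hT : Titer (f n + 1) n ≤ 44 * D ^ 2 := by
    unfold Titer; nlinarith
  have hcK : cN N ^ (f n + 1) ≤ cN N ^ D := Nat.pow_le_pow_right hc hKD
  have hcD1 : 1 ≤ cN N ^ D := Nat.one_le_pow _ _ hc
  have hD3 : D ^ 3 ≤ 2 ^ (3 * D) := by
    calc D ^ 3 ≤ (2 ^ D) ^ 3 := Nat.pow_le_pow_left (Nat.lt_two_pow_self).le 3
      _ = 2 ^ (3 * D) := by rw [← pow_mul, mul_comm]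
  have hcD : cN N ^ D ≤ 2 ^ (cN N * D) := by
    calc cN N ^ D ≤ (2 ^ cN N) ^ D := Nat.pow_le_pow_left (Nat.lt_two_pow_self).le D
      _ = 2 ^ (cN N * D) := by rw [← pow_mul]
  calc gbound N f n = 1 + budget N n (f n + 1) := rfl
    _ ≤ 1 + (f n + 1) * cN N ^ (f n + 1) * Titer (f n + 1) n := by omega
    _ ≤ 1 + D * cN N ^ D * (44 * D ^ 2) :=
      Nat.add_le_add_left (Nat.mul_le_mul (Nat.mul_le_mul hKD hcK) hT) _
    _ ≤ D ^ 3 * cN N ^ D + 44 * (D ^ 3 * cN N ^ D) := by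
      have : 1 ≤ D ^ 3 * cN N ^ D := Nat.one_le_iff_ne_zero.2 (by positivity)
      nlinarith
    _ = 45 * (D ^ 3 * cN N ^ D) := by ring
    _ ≤ 45 * (2 ^ (3 * D) * 2 ^ (cN N * D)) := Nat.mul_le_mul_left _ (Nat.mul_le_mul hD3 hcD)
    _ = 45 * 2 ^ ((3 + cN N) * D) := by rw [← pow_add]; congr 2; ring

variable [Fintype α] {f : ℕ → ℕ}

/-- The simulator runs in time `gbound f` if `N` runs in time `f`. [folklore] -/
theorem simTM_runsInTime (hN : N.RunsInTime f) : (simTM N).RunsInTime (gbound N f) := by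
  intro w
  obtain ⟨K, hK, hh, _⟩ := simTM_spec w hN
  refine hh.mono ?_
  unfold gbound
  exact Nat.add_le_add_left (budget_mono _ (by omega)) _

/-- The simulator decides the language decided by `N`. [folklore] -/
theorem simTM_decides (hN : N.RunsInTime f) {L : Language α} (hL : N.Decides L) :
    (simTM N).Decides L :=
  ⟨(simTM_runsInTime hN).isDecider, fun w =>
    (hL.2 w).trans (simTM_spec w hN).choose_spec.2.2.symm⟩

end Final

end NTIMEProof

open NTIMEProof in
/-- **Thm. 7.11, proved.** `NTIME(t) ⊆ ⋃_c TIME(2^{c·t})` for `t(n) ≥ n`: the deterministic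
single-tape simulator `NTIMEProof.simTM N` of a `t(n)`-time nondeterministic single-tape
machine `N` explores the computation tree of `N` breadth first by address strings (as in the
proof of Sipser's Thm. 3.16, lit p. 161-162) and runs in time `2^{O(t(n))}`; here the three tapes
of Sipser's
simulator are folded directly onto one tape (the address string is carried along
with the simulated head), so Thm. 7.8 is not needed.
[cite: Sipser2012, Thm. 7.11 (§7.1; lit p. 249-250)] -/
theorem NTIME_subset_TIME_two_pow_holds : NTIME_subset_TIME_two_pow := by
  intro α _ t ht L hL
  obtain ⟨N, f, hdec, hrun, hf⟩ := hL
  -- `f ≤ C * t` eventually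
  obtain ⟨C₀, hC₀⟩ := hf.bound
  obtain ⟨n₀, hn₀⟩ := Filter.eventually_atTop.1 hC₀
  have hfC : ∀ n ≥ n₀, f n ≤ ⌈C₀⌉₊ * t n := by
    intro n hn
    have h1 := hn₀ n hn
    simp only [Real.norm_natCast] at h1
    have h2 : (f n : ℝ) ≤ (⌈C₀⌉₊ : ℝ) * t n :=
      h1.trans (mul_le_mul_of_nonneg_right (Nat.le_ceil _) (Nat.cast_nonneg _))
    exact_mod_cast h2
  refine Set.mem_iUnion.2 ⟨(3 + cN N) * (⌈C₀⌉₊ + 1), simTM N, gbound N f, simTM_decides hrun hdec,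
    simTM_runsInTime hrun, ?_⟩
  refine Asymptotics.IsBigO.of_bound (45 * 2 ^ ((3 + cN N) * 2))
    (Filter.eventually_atTop.2 ⟨n₀, fun n hn => ?_⟩)
  have hnat : gbound N f n ≤
      45 * 2 ^ ((3 + cN N) * 2) * 2 ^ ((3 + cN N) * (⌈C₀⌉₊ + 1) * t n) := by
    refine (gbound_le f n).trans ?_
    rw [mul_assoc, ← pow_add]
    refine Nat.mul_le_mul_left _ (Nat.pow_le_pow_right (by norm_num) ?_)
    have h1 := hfC n hn
    have h2 := ht n
    have : f n + n + 2 ≤ (⌈C₀⌉₊ + 1) * t n + 2 := by nlinarith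
    calc (3 + cN N) * (f n + n + 2) ≤ (3 + cN N) * ((⌈C₀⌉₊ + 1) * t n + 2) :=
        Nat.mul_le_mul_left _ this
      _ = (3 + cN N) * 2 + (3 + cN N) * (⌈C₀⌉₊ + 1) * t n := by ring
  simp only [Real.norm_natCast, Nat.cast_pow, Nat.cast_ofNat]
  rw [Real.norm_of_nonneg (by positivity)]
  exact_mod_cast hnat

end Literature.Computability.Complexity.Sipser
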